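import Literature.Computability.Complexity.NumProgramsProductTree
import HarnessLib

/-!
# Numeric register programs, VI: division with remainder and the remainder tree

Literature / complexity toolkit, continuing `NumProgramsProductTree.lean`.  Fast division of
polynomials over `ℤ/N` by a *monic* divisor — Newton iteration for the inverse of the reversed
divisor modulo `x^k` (division-free in the scalars: the reversal of a monic polynomial has
constant term `1`), the quotient by one more product, the remainder by a subtraction — and,
descending the subproduct tree with it, multipoint evaluation (the *remainder tree*).  Harvey's
algorithm needs multipoint evaluation at the points of an arithmetic progression for the
Pollard–Strassen search for small factors (Harvey 2021, Prop. 2.5) and nowhere else; the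
textbook route formalised here is von zur Gathen–Gerhard, *Modern Computer Algebra*, §9.1
(Algorithm 9.3 inversion by Newton iteration, Theorem 9.4; Algorithm 9.5 fast division with
remainder, Theorem 9.6) and §10.1 (Algorithm 10.5 going down the subproduct tree,
Theorem 10.6).

Contents (mathematics first, then programs):

* truncation `ptrunc k p` and congruences modulo `x^k`; **`newton_step`**: if
  `x^k ∣ h g - 1` then `x^{2k} ∣ h (2 g - h g²) - 1`; reversal of coefficient lists
  (`listPoly_reverse`); the division identity **`reflect_divMod`**:
  `rev_n a = rev_{n-d} q · rev_d b + x^{n-d+1} rev_{d-1} r`, and the quotient read off a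
  truncated product with an inverse of `rev_d b` (**`ptrunc_reflect_mul_inv`**);
* programs: `revP` (reverse a block), `linP` (coefficientwise `(cu·u + cv·(N - v)) mod N`),
  `invP` (Newton inversion, `invP_spec`), with closed forms for symbolic execution
  (`revP_eq`, `linP_eq`, `pmulP_eq`); the division program `divP` itself is
  `NumProgramsDivision.lean`, the remainder tree `NumProgramsRemTree.lean`.

## References

* J. von zur Gathen, J. Gerhard, *Modern Computer Algebra*, 3rd ed., CUP 2013, §9.1
  (Algorithms 9.3, 9.5; Theorems 9.4, 9.6), §10.1 (Algorithm 10.5, Theorem 10.6)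
  [GathenGerhard2013].
* D. Harvey, *An exponent one-fifth algorithm for deterministic integer factorisation*, Math.
  Comp. 90 (2021), §2.3 (the use of multipoint evaluation in Prop. 2.5) [Harvey2021].
-/

namespace Literature.Computability.Complexity

open _root_.Computability Polynomial

/-! ### Truncation and congruences modulo `x^k` -/

section Trunc

variable {R : Type*} [CommRing R]

/-- The truncation `Σ_{i<k} p_i x^i`. [von zur Gathen–Gerhard 2013, §9.1] [folklore] -/
noncomputable def ptrunc (k : ℕ) (p : R[X]) : R[X] := ∑ i ∈ Finset.range k, C (p.coeff i) * X ^ i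

/-- Coefficients of the truncation. [folklore] -/
theorem coeff_ptrunc (k : ℕ) (p : R[X]) (i : ℕ) : (ptrunc k p).coeff i = if i < k then p.coeff i else 0 := by
  simp only [ptrunc, finsetSum_coeff, coeff_C_mul_X_pow]
  split_ifs with h
  · rw [Finset.sum_eq_single i (fun j _ hj => if_neg (Ne.symm hj)) (fun hi => absurd (Finset.mem_range.2 h) hi), if_pos rfl]
  · exact Finset.sum_eq_zero fun j hj => if_neg (by rintro rfl; exact h (Finset.mem_range.1 hj))

/-- The truncation has degree `< k`. [folklore] -/
theorem coeff_ptrunc_of_le {k : ℕ} {p : R[X]} {i : ℕ} (hi : k ≤ i) : (ptrunc k p).coeff i = 0 := by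
  rw [coeff_ptrunc, if_neg (by omega)]

/-- The truncation has `natDegree < k` (for `k ≥ 1`). [folklore] -/
theorem natDegree_ptrunc_lt {k : ℕ} (hk : 1 ≤ k) (p : R[X]) : (ptrunc k p).natDegree < k := by
  rw [Nat.lt_iff_le_pred hk]
  exact natDegree_le_iff_coeff_eq_zero.2 fun i hi => coeff_ptrunc_of_le (by omega)

/-- Truncations agree iff `x^k` divides the difference. [folklore] -/
theorem ptrunc_eq_iff_dvd {k : ℕ} {p q : R[X]} : ptrunc k p = ptrunc k q ↔ X ^ k ∣ p - q := by
  rw [X_pow_dvd_iff]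
  constructor
  · intro h i hi
    have := congr_arg (fun f => f.coeff i) h
    simp only [coeff_ptrunc, if_pos hi] at this
    rw [coeff_sub, this, sub_self]
  · intro h
    ext i
    simp only [coeff_ptrunc]
    split_ifs with hi
    · exact sub_eq_zero.1 (by rw [← coeff_sub]; exact h i hi)
    · rfl

/-- A polynomial of degree `< k` is its own truncation. [folklore] -/
theorem ptrunc_eq_self {k : ℕ} {p : R[X]} (hp : ∀ i, k ≤ i → p.coeff i = 0) : ptrunc k p = p := by
  ext i; rw [coeff_ptrunc]; split_ifs with hi; · rfl
  · exact (hp i (by omega)).symm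

/-- `x^k` divides `p - ptrunc k p`. [folklore] -/
theorem X_pow_dvd_sub_ptrunc (k : ℕ) (p : R[X]) : X ^ k ∣ p - ptrunc k p := by
  rw [X_pow_dvd_iff]; intro i hi; rw [coeff_sub, coeff_ptrunc, if_pos hi, sub_self]

/-- Truncation is idempotent. [folklore] -/
theorem ptrunc_ptrunc (k : ℕ) (p : R[X]) : ptrunc k (ptrunc k p) = ptrunc k p := by
  ext i; simp only [coeff_ptrunc]; split_ifs <;> rfl

/-- Low coefficients of a product only depend on low coefficients of the factors. [folklore] -/
theorem ptrunc_mul_left (k : ℕ) (p q : R[X]) : ptrunc k (ptrunc k p * q) = ptrunc k (p * q) := by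
  rw [ptrunc_eq_iff_dvd, ← sub_mul, ← neg_sub, neg_mul]
  exact dvd_neg.2 ((X_pow_dvd_sub_ptrunc k p).mul_right q)

/-- Low coefficients of a product only depend on low coefficients of the factors. [folklore] -/
theorem ptrunc_mul_right (k : ℕ) (p q : R[X]) : ptrunc k (p * ptrunc k q) = ptrunc k (p * q) := by
  rw [mul_comm, ptrunc_mul_left, mul_comm]

/-- Truncations are additive. [folklore] -/
theorem ptrunc_sub (k : ℕ) (p q : R[X]) : ptrunc k (p - q) = ptrunc k p - ptrunc k q := by
  ext i; simp only [coeff_ptrunc, coeff_sub]; split_ifs <;> simp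

/-- Restricting a truncation. [folklore] -/
theorem ptrunc_ptrunc_of_le {j k : ℕ} (h : j ≤ k) (p : R[X]) : ptrunc j (ptrunc k p) = ptrunc j p := by
  ext i; simp only [coeff_ptrunc]; split_ifs with h1 h2 <;> first | rfl | omega

/-- **Newton's step for the inverse modulo `x^k`**: if `h g ≡ 1 (mod x^k)` then
`h (2g - h g²) ≡ 1 (mod x^{2k})`, because `1 - h (2 g - h g²) = (1 - h g)²`.
[von zur Gathen–Gerhard 2013, Theorem 9.4] [folklore] -/
theorem newton_step {h g : R[X]} {k : ℕ} (hg : X ^ k ∣ h * g - 1) : X ^ (2 * k) ∣ h * (2 * g - h * g ^ 2) - 1 := by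
  obtain ⟨s, hs⟩ := hg
  refine ⟨-(s ^ 2), ?_⟩
  have : h * g = 1 + X ^ k * s := by rw [← hs]; ring
  calc h * (2 * g - h * g ^ 2) - 1 = 2 * (h * g) - (h * g) ^ 2 - 1 := by ring
    _ = -(X ^ k * s) ^ 2 := by rw [this]; ring
    _ = X ^ (2 * k) * -(s ^ 2) := by ring

/-- Congruences modulo `x^k` are preserved by multiplication. [folklore] -/
theorem X_pow_dvd_mul_sub_mul {k : ℕ} {p q : R[X]} (r : R[X]) (h : X ^ k ∣ p - q) : X ^ k ∣ r * p - r * q := by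
  rw [← mul_sub]; exact h.mul_left r

/-- Weakening the modulus. [folklore] -/
theorem X_pow_dvd_of_le {j k : ℕ} (hjk : j ≤ k) {p : R[X]} (h : X ^ k ∣ p) : X ^ j ∣ p :=
  (pow_dvd_pow X hjk).trans h

end Trunc

/-! ### Reversal -/

section Reflect

variable {R : Type*} [CommRing R]

/-- `reflect` is an involution. [folklore] -/
theorem reflect_reflect (n : ℕ) (p : R[X]) : reflect n (reflect n p) = p := by
  ext i; rw [coeff_reflect, coeff_reflect, revAt_invol]

/-- A reflection at a larger index is a shift of the reflection at the degree bound. [folklore] -/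
theorem reflect_eq_X_pow_mul_reflect {m n : ℕ} {p : R[X]} (hp : p.natDegree ≤ m) (hmn : m ≤ n) :
    reflect n p = X ^ (n - m) * reflect m p := by
  ext i
  rw [coeff_reflect, coeff_X_pow_mul']
  split_ifs with h
  · rw [coeff_reflect]
    by_cases hi : i ≤ n
    · rw [revAt_le hi, revAt_le (by omega)]; congr 1; omega
    · rw [revAt_eq_self_of_lt (by omega), revAt_eq_self_of_lt (by omega)]
      rw [coeff_eq_zero_of_natDegree_lt (by omega), coeff_eq_zero_of_natDegree_lt (by omega)]
  · rw [not_le] at h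
    rw [revAt_le (by omega)]
    exact coeff_eq_zero_of_natDegree_lt (by omega)

/-- The reflection at the degree bound has the same degree bound. [folklore] -/
theorem coeff_reflect_eq_zero_of_lt {m : ℕ} {p : R[X]} (hp : p.natDegree ≤ m) {i : ℕ} (hi : m < i) : (reflect m p).coeff i = 0 := by
  rw [coeff_reflect, revAt_eq_self_of_lt hi]; exact coeff_eq_zero_of_natDegree_lt (by omega)

/-- **The division identity, reversed** (von zur Gathen–Gerhard 2013, (9.3) before Algorithm
9.5): for `b` monic of degree `d ≥ 1` and `deg a ≤ n`, `d ≤ n`,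
`rev_n a = rev_{n-d} (a div b) · rev_d b + x^{n-d+1} · rev_{d-1} (a mod b)`. [folklore] -/
theorem reflect_divMod [Nontrivial R] {a b : R[X]} {n d : ℕ} (hb : b.Monic) (hd : b.natDegree = d) (hd1 : 1 ≤ d)
    (ha : a.natDegree ≤ n) (hdn : d ≤ n) :
    reflect n a = reflect (n - d) (a /ₘ b) * reflect d b + X ^ (n - d + 1) * reflect (d - 1) (a %ₘ b) := by
  have hdiv := modByMonic_add_div a b
  have hq : (a /ₘ b).natDegree ≤ n - d := by rw [natDegree_divByMonic a hb, hd]; omega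
  have hr : (a %ₘ b).natDegree ≤ d - 1 := by
    have hb1 : b ≠ 1 := by rintro rfl; simp at hd; omega
    have := natDegree_modByMonic_lt a hb hb1
    omega
  conv_lhs => rw [← hdiv, add_comm, reflect_add]
  rw [show n = (n - d) + d from (Nat.sub_add_cancel hdn).symm, mul_comm b, reflect_mul _ _ hq hd.le, Nat.sub_add_cancel hdn,
    reflect_eq_X_pow_mul_reflect hr (show d - 1 ≤ n by omega)]
  congr 3; omega

/-- **The quotient from an approximate inverse of the reversed divisor** (von zur
Gathen–Gerhard 2013, Theorem 9.6): with `m = n - d` and `x^{m+1} ∣ rev_d b · G - 1`,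
`trunc_{m+1} (rev_n a · G) = rev_m (a div b)`. [folklore] -/
theorem ptrunc_reflect_mul_inv [Nontrivial R] {a b G : R[X]} {n d : ℕ} (hb : b.Monic) (hd : b.natDegree = d) (hd1 : 1 ≤ d)
    (ha : a.natDegree ≤ n) (hdn : d ≤ n) (hG : X ^ (n - d + 1) ∣ reflect d b * G - 1) :
    ptrunc (n - d + 1) (reflect n a * G) = reflect (n - d) (a /ₘ b) := by
  have hq : (a /ₘ b).natDegree ≤ n - d := by rw [natDegree_divByMonic a hb, hd]; omega
  rw [← ptrunc_eq_self (k := n - d + 1) (p := reflect (n - d) (a /ₘ b)) fun i hi => coeff_reflect_eq_zero_of_lt hq (by omega),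
    ptrunc_eq_iff_dvd, reflect_divMod hb hd hd1 ha hdn, add_mul, mul_assoc,
    show reflect (n - d) (a /ₘ b) * (reflect d b * G) + X ^ (n - d + 1) * reflect (d - 1) (a %ₘ b) * G - reflect (n - d) (a /ₘ b) =
      reflect (n - d) (a /ₘ b) * (reflect d b * G - 1) + X ^ (n - d + 1) * (reflect (d - 1) (a %ₘ b) * G) by ring]
  exact dvd_add (hG.mul_left _) (dvd_mul_right _ _)

end Reflect

/-! ### Coefficient lists: reversal, truncation, linear combinations -/

section Lists

variable {N : ℕ}

/-- Reversing a coefficient list reflects the polynomial. [folklore] -/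
theorem listPoly_reverse (l : List ℕ) : listPoly N l.reverse = reflect (l.length - 1) (listPoly N l) := by
  ext i
  rw [coeff_listPoly, coeff_reflect, coeff_listPoly]
  rcases Nat.lt_or_ge i l.length with hi | hi
  · rw [revAt_le (by omega), List.getD_eq_getElem _ _ (by simpa using hi), List.getD_eq_getElem _ _ (by omega), List.getElem_reverse]
  · rw [List.getD_eq_default _ _ (by simpa using hi)]
    rcases Nat.lt_or_ge (l.length - 1) i with h1 | h1
    · rw [revAt_eq_self_of_lt h1, List.getD_eq_default _ _ hi]
    · have : l.length = 0 := by omega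
      rw [List.getD_eq_default _ _ (by omega)]

/-- Taking a prefix truncates the polynomial. [folklore] -/
theorem listPoly_take (k : ℕ) (l : List ℕ) : listPoly N (l.take k) = ptrunc k (listPoly N l) := by
  ext i
  rw [coeff_listPoly, coeff_ptrunc, coeff_listPoly]
  split_ifs with hi
  · rcases Nat.lt_or_ge i l.length with h | h
    · rw [List.getD_eq_getElem _ _ (by simp [hi, h]), List.getD_eq_getElem _ _ h, List.getElem_take]
    · rw [List.getD_eq_default _ _ (by simp [h]), List.getD_eq_default _ _ h]
  · rw [List.getD_eq_default _ _ (by simp; omega), Nat.cast_zero]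

/-- The natural degree of a coefficient list is below its length. [folklore] -/
theorem natDegree_listPoly_lt {l : List ℕ} (hl : 1 ≤ l.length) : (listPoly N l).natDegree < l.length := by
  rw [Nat.lt_iff_le_pred hl]
  exact natDegree_le_iff_coeff_eq_zero.2 fun i hi => by
    rw [coeff_listPoly, List.getD_eq_default _ _ (by exact_mod_cast (by omega : l.length ≤ i)), Nat.cast_zero]

/-- The coefficientwise combination `(2 u_i + N - v_i) mod N` (with `u` padded by zeros). [folklore] -/
def lin2 (N : ℕ) (u v : List ℕ) : List ℕ := (List.range v.length).map fun i => (2 * u.getD i 0 + (N - v.getD i 0)) % N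

/-- The coefficientwise difference `(u_i + N - v_i) mod N` (with `u` padded by zeros). [folklore] -/
def lin1 (N : ℕ) (u v : List ℕ) : List ℕ := (List.range v.length).map fun i => (u.getD i 0 + (N - v.getD i 0)) % N

/-- Length of `lin2`. [folklore] -/
@[simp] theorem length_lin2 (u v : List ℕ) : (lin2 N u v).length = v.length := by simp [lin2]

/-- Length of `lin1`. [folklore] -/
@[simp] theorem length_lin1 (u v : List ℕ) : (lin1 N u v).length = v.length := by simp [lin1]

/-- Entries of `lin2` are reduced (`0 < N`). [folklore] -/
theorem lt_of_mem_lin2 (hN : 0 < N) {u v : List ℕ} {x : ℕ} (hx : x ∈ lin2 N u v) : x < N := by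
  simp only [lin2, List.mem_map, List.mem_range] at hx
  obtain ⟨i, -, rfl⟩ := hx; exact Nat.mod_lt _ hN

/-- Entries of `lin1` are reduced (`0 < N`). [folklore] -/
theorem lt_of_mem_lin1 (hN : 0 < N) {u v : List ℕ} {x : ℕ} (hx : x ∈ lin1 N u v) : x < N := by
  simp only [lin1, List.mem_map, List.mem_range] at hx
  obtain ⟨i, -, rfl⟩ := hx; exact Nat.mod_lt _ hN

/-- `lin2` codes `2 u - v` truncated to `|v|` (entries of `v` reduced). [folklore] -/
theorem listPoly_lin2 {u v : List ℕ} (hv : ∀ b ∈ v, b < N) :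
    listPoly N (lin2 N u v) = ptrunc v.length (2 * listPoly N u - listPoly N v) := by
  ext i
  rw [coeff_listPoly, coeff_ptrunc]
  split_ifs with hi
  · have hlen : i < v.length := hi
    have hvi : v.getD i 0 < N := by rw [List.getD_eq_getElem _ _ hlen]; exact hv _ (List.getElem_mem hlen)
    rw [lin2, List.getD_eq_getElem _ _ (by simpa using hi), List.getElem_map, List.getElem_range, coeff_sub, coeff_listPoly (v := v),
      ZMod.natCast_mod, Nat.cast_add, Nat.cast_mul, Nat.cast_sub hvi.le, ZMod.natCast_self, zero_sub, Nat.cast_ofNat,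
      show (2 * listPoly N u).coeff i = 2 * (u.getD i 0 : ZMod N) by rw [show (2 : (ZMod N)[X]) = C 2 from rfl, coeff_C_mul, coeff_listPoly]]
    ring
  · rw [lin2, List.getD_eq_default _ _ (by simpa using hi), Nat.cast_zero]

/-- `lin1` codes `u - v` truncated to `|v|` (entries of `v` reduced). [folklore] -/
theorem listPoly_lin1 {u v : List ℕ} (hv : ∀ b ∈ v, b < N) :
    listPoly N (lin1 N u v) = ptrunc v.length (listPoly N u - listPoly N v) := by
  ext i
  rw [coeff_listPoly, coeff_ptrunc]
  split_ifs with hi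
  · have hlen : i < v.length := hi
    have hvi : v.getD i 0 < N := by rw [List.getD_eq_getElem _ _ hlen]; exact hv _ (List.getElem_mem hlen)
    rw [lin1, List.getD_eq_getElem _ _ (by simpa using hi), List.getElem_map, List.getElem_range, coeff_sub, coeff_listPoly (v := v),
      coeff_listPoly (v := u), ZMod.natCast_mod, Nat.cast_add, Nat.cast_sub hvi.le, ZMod.natCast_self, zero_sub]
    ring
  · rw [lin1, List.getD_eq_default _ _ (by simpa using hi), Nat.cast_zero]

/-- A coefficient list of length `d + 1` ending in `1` codes a monic polynomial of degree `d`
(`1 < N`). [folklore] -/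
theorem monic_listPoly_of_getLast (hN : 1 < N) {B : List ℕ} {d : ℕ} (hB : B.length = d + 1) (hlast : B.getLast? = some 1) :
    (listPoly N B).Monic ∧ (listPoly N B).natDegree = d := by
  haveI : Fact (1 < N) := ⟨hN⟩
  have hBd : B[d]? = some 1 := by rw [List.getLast?_eq_getElem?, hB, Nat.add_sub_cancel] at hlast; exact hlast
  have hcd : (listPoly N B).coeff d = 1 := by
    rw [coeff_listPoly, List.getD_eq_getElem?_getD, hBd, Option.getD_some, Nat.cast_one]
  have hle : (listPoly N B).natDegree ≤ d := by
    have := natDegree_listPoly_lt (N := N) (l := B) (by omega); omega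
  have hmon : (listPoly N B).Monic := Polynomial.monic_of_natDegree_le_of_coeff_eq_one d hle hcd
  exact ⟨hmon, le_antisymm hle (Polynomial.le_natDegree_of_ne_zero (by rw [hcd]; exact one_ne_zero))⟩

end Lists


namespace NCom

variable {S V O X E : Type} [DecidableEq S] [DecidableEq V] [DecidableEq O] (𝓔 : NExt S V O X E)

/-! ### Reversing a block -/

section Rev

/-- `revP v w x cnt`: move the first `cnt` entries of `v`, reversed, to the front of `w`.
[folklore] -/
def revP (v w : V) (x cnt : S) : NCom S V O E := times cnt (pop v x ;ₙ push w x)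

omit [DecidableEq S] [DecidableEq V] [DecidableEq O] in
/-- `revP` has no extension calls. [folklore] -/
theorem revP_noExt (v w : V) (x cnt : S) : (revP v w x cnt : NCom S V O E).noExt := by simp [revP, noExt]

/-- Rounds of `revP` (`v ≠ w`). [folklore] -/
theorem revP_iterate {v w : V} (hvw : v ≠ w) (x : S) (σ : NState S V O) :
    ∀ j, j ≤ (σ.vi v).length → let υ := ((pop v x ;ₙ push w x : NCom S V O E).eval 𝓔)^[j] σ
      υ.vi v = (σ.vi v).drop j ∧ υ.vi w = ((σ.vi v).take j).reverse ++ σ.vi w ∧ (∀ s, s ≠ x → υ.sc s = σ.sc s) ∧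
        (∀ u, u ≠ v → u ≠ w → υ.vi u = σ.vi u) ∧ υ.vo = σ.vo ∧ υ.peak = σ.peak ∧ υ.steps = σ.steps + 2 * j
  | 0, _ => ⟨rfl, by simp, fun _ _ => rfl, fun _ _ _ => rfl, rfl, rfl, rfl⟩
  | j + 1, hj => by
    obtain ⟨h1, h2, h3, h4, h5, h6, h7⟩ := revP_iterate hvw x σ j (Nat.le_of_succ_le hj)
    intro υ
    set υ₀ := ((pop v x ;ₙ push w x : NCom S V O E).eval 𝓔)^[j] σ with hυ₀
    have hυ : υ = (pop v x ;ₙ push w x : NCom S V O E).eval 𝓔 υ₀ := Function.iterate_succ_apply' _ _ _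
    have hne : (σ.vi v).drop j ≠ [] := by rw [Ne, List.drop_eq_nil_iff]; omega
    obtain ⟨a, l, hal⟩ : ∃ a l, (σ.vi v).drop j = a :: l := List.exists_cons_of_ne_nil hne
    have hhead : υ₀.vi v = a :: l := h1.trans hal
    have hx : a = (σ.vi v)[j]'(by omega) := by
      have := List.drop_eq_getElem_cons (l := σ.vi v) (i := j) (by omega)
      rw [this] at hal; exact (List.cons.inj hal).1.symm
    rw [hυ]
    refine ⟨?_, ?_, fun s hs => ?_, fun u hu hu' => ?_, ?_, ?_, ?_⟩
    · simp only [eval, NState.vi_bump, NState.vi_setVi, NState.vi_setSc, Function.update_of_ne hvw, Function.update_self, hhead, List.tail_cons]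
      rw [← List.drop_drop, hal]; rfl
    · simp only [eval, NState.vi_bump, NState.vi_setVi, NState.sc_setVi, NState.sc_bump, NState.sc_setSc, Function.update_self, hhead,
        List.headD_cons, NState.vi_setSc, Function.update_of_ne hvw.symm, h2]
      rw [hx, List.take_succ_eq_append_getElem (by omega), List.reverse_append, List.reverse_singleton, List.singleton_append, List.cons_append]
    · simp [eval, hs, h3 s hs]
    · simp [eval, hu, hu', h4 u hu hu']
    · simp [eval, h5]
    · simp [eval, h6]
    · simp [eval, h7]; ring

/-- **Specification of `revP`** (`cnt ≤ |v|`, `v ≠ w`). [folklore] -/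
theorem revP_spec {v w : V} (hvw : v ≠ w) (x cnt : S) (σ : NState S V O) (h : σ.sc cnt ≤ (σ.vi v).length) :
    let τ := (revP v w x cnt : NCom S V O E).eval 𝓔 σ
    τ.vi v = (σ.vi v).drop (σ.sc cnt) ∧ τ.vi w = ((σ.vi v).take (σ.sc cnt)).reverse ++ σ.vi w ∧
      (∀ s, s ≠ x → τ.sc s = σ.sc s) ∧ (∀ u, u ≠ v → u ≠ w → τ.vi u = σ.vi u) ∧ τ.vo = σ.vo ∧
      τ.peak = σ.peak ∧ τ.steps = σ.steps + 3 * σ.sc cnt + 1 := by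
  intro τ
  obtain ⟨h1, h2, h3, h4, h5, h6, h7⟩ := revP_iterate 𝓔 hvw x (σ.bump 0 (σ.sc cnt + 1)) (σ.sc cnt) (by simpa using h)
  simp only [NState.vi_bump, NState.vo_bump, NState.sc_bump, NState.peak_bump, NState.steps_bump, Nat.max_zero] at h1 h2 h3 h4 h5 h6 h7
  exact ⟨h1, h2, h3, h4, h5, h6, by rw [show τ.steps = _ from h7]; ring⟩

end Rev

/-! ### Coefficientwise linear combinations modulo `N` -/

/-- Scalar roles of `linP`: the modulus, the two multipliers, the count, scratch. [folklore] -/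
inductive LinS where
  | n | cu | cv | cnt | a | b | y | q | r
  deriving DecidableEq, Fintype

section Lin

variable (ρ : LinS ↪ S) (u v : V) (o : O)

/-- One coefficient: `r := (cu · u_i + cv · (N - v_i)) mod N`, appended to `o`. [folklore] -/
def linBody : NCom S V O E :=
  pop u (ρ .a) ;ₙ pop v (ρ .b) ;ₙ mul (ρ .y) (ρ .cu) (ρ .a) ;ₙ sub (ρ .b) (ρ .n) (ρ .b) ;ₙ mul (ρ .b) (ρ .cv) (ρ .b) ;ₙ
  add (ρ .y) (ρ .y) (ρ .b) ;ₙ divmod (ρ .q) (ρ .r) (ρ .y) (ρ .n) ;ₙ emit o (ρ .r)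

/-- `linP ρ u v o`: for `cnt` rounds, pop `u_i` (zero once `u` is exhausted) and `v_i` and
append `(cu · u_i + cv · (N - v_i)) mod N` to `o`. [folklore] -/
def linP : NCom S V O E := times (ρ .cnt) (linBody ρ u v o)

omit [DecidableEq S] [DecidableEq V] [DecidableEq O] in
/-- `linP` has no extension calls. [folklore] -/
theorem linP_noExt : (linP ρ u v o : NCom S V O E).noExt := by simp [linP, linBody, noExt]

/-- The general coefficientwise combination `(cu u_i + cv (N - v_i)) mod N`, `i < j`. [folklore] -/
def linc (N cu cv : ℕ) (us vs : List ℕ) (j : ℕ) : List ℕ := (List.range j).map fun i => (cu * us.getD i 0 + cv * (N - vs.getD i 0)) % N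

/-- `lin2` is `linc` with multipliers `2, 1`. [folklore] -/
theorem lin2_eq_linc (N : ℕ) (us vs : List ℕ) : lin2 N us vs = linc N 2 1 us vs vs.length := by simp [lin2, linc]

/-- `lin1` is `linc` with multipliers `1, 1`. [folklore] -/
theorem lin1_eq_linc (N : ℕ) (us vs : List ℕ) : lin1 N us vs = linc N 1 1 us vs vs.length := by simp [lin1, linc]

/-- An entry read with default `0` is bounded by a bound of the entries. [folklore] -/
theorem getD_le_of_forall_le {l : List ℕ} {U : ℕ} (h : ∀ a ∈ l, a ≤ U) (j : ℕ) : l.getD j 0 ≤ U := by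
  rcases Nat.lt_or_ge j l.length with hj | hj
  · rw [List.getD_eq_getElem _ _ hj]; exact h _ (List.getElem_mem hj)
  · rw [List.getD_eq_default _ _ hj]; exact Nat.zero_le _

/-- Rounds of `linP` (`u ≠ v`; `U` bounds the entries of `u`). [folklore] -/
theorem linP_iterate (huv : u ≠ v) (σ : NState S V O) {U : ℕ} (hU : ∀ a ∈ σ.vi u, a ≤ U) :
    ∀ j, j ≤ (σ.vi v).length → let υ := ((linBody ρ u v o : NCom S V O E).eval 𝓔)^[j] σ
      υ.vi u = (σ.vi u).drop j ∧ υ.vi v = (σ.vi v).drop j ∧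
        υ.vo o = σ.vo o ++ linc (σ.sc (ρ .n)) (σ.sc (ρ .cu)) (σ.sc (ρ .cv)) (σ.vi u) (σ.vi v) j ∧
        (∀ s : LinS, s ≠ .a → s ≠ .b → s ≠ .y → s ≠ .q → s ≠ .r → υ.sc (ρ s) = σ.sc (ρ s)) ∧ (∀ s, (∀ i, s ≠ ρ i) → υ.sc s = σ.sc s) ∧
        (∀ w, w ≠ u → w ≠ v → υ.vi w = σ.vi w) ∧ (∀ p, p ≠ o → υ.vo p = σ.vo p) ∧
        υ.peak ≤ max σ.peak (σ.sc (ρ .cu) * U + σ.sc (ρ .cv) * σ.sc (ρ .n)) ∧ υ.steps = σ.steps + 8 * j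
  | 0, _ => ⟨rfl, rfl, by simp [linc], fun _ _ _ _ _ _ => rfl, fun _ _ => rfl, fun _ _ _ => rfl, fun _ _ => rfl, le_max_left _ _, rfl⟩
  | j + 1, hj => by
    obtain ⟨h1, h2, h3, h4, h5, h6, h7, h8, h9⟩ := linP_iterate huv σ hU j (Nat.le_of_succ_le hj)
    intro υ
    set υ₀ := ((linBody ρ u v o : NCom S V O E).eval 𝓔)^[j] σ with hυ₀
    have hυ : υ = (linBody ρ u v o : NCom S V O E).eval 𝓔 υ₀ := Function.iterate_succ_apply' _ _ _
    have hb : (υ₀.vi v).headD 0 = (σ.vi v).getD j 0 := by rw [h2, List.getD_eq_getElem?_getD, ← List.head?_drop, List.headD_eq_head?_getD]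
    have ha : (υ₀.vi u).headD 0 = (σ.vi u).getD j 0 := by rw [h1, List.getD_eq_getElem?_getD, ← List.head?_drop, List.headD_eq_head?_getD]
    have hcu := h4 .cu (by simp) (by simp) (by simp) (by simp) (by simp)
    have hcv := h4 .cv (by simp) (by simp) (by simp) (by simp) (by simp)
    have hn := h4 .n (by simp) (by simp) (by simp) (by simp) (by simp)
    rw [hυ]
    refine ⟨?_, ?_, ?_, fun s s1 s2 s3 s4 s5 => ?_, fun s hs => ?_, fun w hw hw' => ?_, fun p hp => ?_, ?_, ?_⟩
    · simp only [linBody, eval, NState.vi_bump, NState.vi_setVo, NState.vi_setSc, NState.vi_setVi, Function.update_of_ne huv, Function.update_self,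
        h1, List.tail_drop]
    · simp only [linBody, eval, NState.vi_bump, NState.vi_setVo, NState.vi_setSc, NState.vi_setVi, Function.update_self,
        Function.update_of_ne (Ne.symm huv), h2, List.tail_drop]
    · simp only [linBody, eval, NState.vo_bump, NState.vo_setVo, NState.sc_bump, NState.sc_setSc, NState.sc_setVi,
        Function.update_self, NState.vo_setSc, NState.vo_setVi, h3, List.append_assoc, NState.vi_setSc, NState.vi_bump, NState.vi_setVi,
        Function.update_of_ne (Ne.symm huv), hb, ha]
      rw [linc, linc, List.range_succ, List.map_append, List.map_singleton]
      congr 2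
      simp [hcu, hcv, hn]
    · simp [linBody, eval, s1, s2, s3, s4, s5, h4 s s1 s2 s3 s4 s5]
    · simp [linBody, eval, hs, h5 s hs]
    · simp [linBody, eval, hw, hw', h6 w hw hw']
    · simp [linBody, eval, hp, h7 p hp]
    · have hau : σ.sc (ρ .cu) * (σ.vi u).getD j 0 ≤ σ.sc (ρ .cu) * U := Nat.mul_le_mul_left _ (getD_le_of_forall_le hU j)
      have hbv : σ.sc (ρ .cv) * (σ.sc (ρ .n) - (σ.vi v).getD j 0) ≤ σ.sc (ρ .cv) * σ.sc (ρ .n) := Nat.mul_le_mul_left _ (Nat.sub_le _ _)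
      simp only [linBody, eval, NState.peak_bump, NState.peak_setVo, NState.peak_setSc, NState.peak_setVi, NState.sc_setSc, NState.sc_setVi,
        NState.sc_bump, Function.update_apply, EmbeddingLike.apply_eq_iff_eq, reduceCtorEq, ite_true, ite_false, Nat.max_zero, ha,
        NState.vi_setSc, NState.vi_bump, NState.vi_setVi, Ne.symm huv, hb, hcu, hcv, hn]
      omega
    · simp [linBody, eval, h9]; ring

/-- **Specification of `linP`** (`cnt ≤ |v|`, `u ≠ v`; entries of `u` at most `U`): `o` gains
`linc N cu cv u v cnt`, both queues lose `cnt` entries (`u` fewer if shorter).  [folklore] -/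
theorem linP_spec (huv : u ≠ v) (σ : NState S V O) {U : ℕ} (hU : ∀ a ∈ σ.vi u, a ≤ U) (h : σ.sc (ρ .cnt) ≤ (σ.vi v).length) :
    let τ := (linP ρ u v o : NCom S V O E).eval 𝓔 σ
    τ.vi u = (σ.vi u).drop (σ.sc (ρ .cnt)) ∧ τ.vi v = (σ.vi v).drop (σ.sc (ρ .cnt)) ∧
      τ.vo o = σ.vo o ++ linc (σ.sc (ρ .n)) (σ.sc (ρ .cu)) (σ.sc (ρ .cv)) (σ.vi u) (σ.vi v) (σ.sc (ρ .cnt)) ∧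
      (∀ s : LinS, s ≠ .a → s ≠ .b → s ≠ .y → s ≠ .q → s ≠ .r → τ.sc (ρ s) = σ.sc (ρ s)) ∧ (∀ s, (∀ i, s ≠ ρ i) → τ.sc s = σ.sc s) ∧
      (∀ w, w ≠ u → w ≠ v → τ.vi w = σ.vi w) ∧ (∀ p, p ≠ o → τ.vo p = σ.vo p) ∧
      τ.peak ≤ max σ.peak (σ.sc (ρ .cu) * U + σ.sc (ρ .cv) * σ.sc (ρ .n)) ∧ τ.steps = σ.steps + 9 * σ.sc (ρ .cnt) + 1 := by
  intro τ
  obtain ⟨h1, h2, h3, h4, h5, h6, h7, h8, h9⟩ := linP_iterate 𝓔 ρ u v o huv (σ.bump 0 (σ.sc (ρ .cnt) + 1)) (by simpa using hU) (σ.sc (ρ .cnt))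
    (by simpa using h)
  simp only [NState.vi_bump, NState.vo_bump, NState.sc_bump, NState.peak_bump, NState.steps_bump, Nat.max_zero] at h1 h2 h3 h4 h5 h6 h7 h8 h9
  exact ⟨h1, h2, h3, h4, h5, h6, h7, h8, by rw [show τ.steps = _ from h9]; ring⟩

/-- `linc` with `j = |v|` and `cu = c`, `cv = 1` codes `ptrunc |v| (c · U - V)` (entries of `v`
reduced). [folklore] -/
theorem listPoly_linc {N c : ℕ} {us vs : List ℕ} (hv : ∀ b ∈ vs, b < N) :
    listPoly N (linc N c 1 us vs vs.length) = ptrunc vs.length ((c : (ZMod N)[X]) * listPoly N us - listPoly N vs) := by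
  ext i
  rw [coeff_listPoly, coeff_ptrunc]
  split_ifs with hi
  · have hvi : vs.getD i 0 < N := by rw [List.getD_eq_getElem _ _ hi]; exact hv _ (List.getElem_mem hi)
    rw [linc, List.getD_eq_getElem _ _ (by simpa using hi), List.getElem_map, List.getElem_range, coeff_sub, coeff_listPoly (v := vs),
      ZMod.natCast_mod, Nat.one_mul, Nat.cast_add, Nat.cast_mul, Nat.cast_sub hvi.le, ZMod.natCast_self, zero_sub,
      show ((c : (ZMod N)[X]) * listPoly N us).coeff i = (c : ZMod N) * (us.getD i 0 : ZMod N) by rw [← C_eq_natCast, coeff_C_mul, coeff_listPoly]]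
    ring
  · rw [linc, List.getD_eq_default _ _ (by simpa using hi), Nat.cast_zero]

/-- `linc` with `cv = x`, `cu = 1` codes `ptrunc |v| (U - x V)`. [folklore] -/
theorem listPoly_linc' {N x : ℕ} {us vs : List ℕ} (hv : ∀ b ∈ vs, b < N) :
    listPoly N (linc N 1 x us vs vs.length) = ptrunc vs.length (listPoly N us - (x : (ZMod N)[X]) * listPoly N vs) := by
  ext i
  rw [coeff_listPoly, coeff_ptrunc]
  split_ifs with hi
  · have hvi : vs.getD i 0 < N := by rw [List.getD_eq_getElem _ _ hi]; exact hv _ (List.getElem_mem hi)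
    rw [linc, List.getD_eq_getElem _ _ (by simpa using hi), List.getElem_map, List.getElem_range, coeff_sub, coeff_listPoly (v := us),
      ZMod.natCast_mod, Nat.one_mul, Nat.cast_add, Nat.cast_mul, Nat.cast_sub hvi.le, ZMod.natCast_self, zero_sub,
      show ((x : (ZMod N)[X]) * listPoly N vs).coeff i = (x : ZMod N) * (vs.getD i 0 : ZMod N) by rw [← C_eq_natCast, coeff_C_mul, coeff_listPoly]]
    ring
  · rw [linc, List.getD_eq_default _ _ (by simpa using hi), Nat.cast_zero]

/-- Entries of `linc` are reduced (`0 < N`). [folklore] -/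
theorem lt_of_mem_linc {N cu cv : ℕ} (hN : 0 < N) {us vs : List ℕ} {j x : ℕ} (hx : x ∈ linc N cu cv us vs j) : x < N := by
  simp only [linc, List.mem_map, List.mem_range] at hx
  obtain ⟨i, -, rfl⟩ := hx; exact Nat.mod_lt _ hN

/-- Length of `linc`. [folklore] -/
@[simp] theorem length_linc (N cu cv : ℕ) (us vs : List ℕ) (j : ℕ) : (linc N cu cv us vs j).length = j := by simp [linc]

/-- `linc` only reads the first `j` entries of `v`. [folklore] -/
theorem linc_take (N cu cv : ℕ) (us vs : List ℕ) (j : ℕ) : linc N cu cv us vs j = linc N cu cv us (vs.take j) j := by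
  unfold linc
  refine List.map_congr_left fun i hi => ?_
  rw [List.mem_range] at hi
  simp only [List.getD_eq_getElem?_getD, List.getElem?_take, if_pos hi]

/-- **One Newton round on coefficient lists.**  With `k2 = min (2|g|, |h|)` and
`g' = (2 g - (g² · (h mod x^{k2})) mod x^{k2}) mod x^{k2}` coefficientwise:
if `x^{|g|} ∣ h g - 1` then `x^{k2} ∣ h g' - 1`. [von zur Gathen–Gerhard 2013, Theorem 9.4]
[folklore] -/
theorem newton_linc {N : ℕ} (hN : 1 < N) {h g : List ℕ} (hk1 : 1 ≤ g.length)
    (hinv : Polynomial.X ^ g.length ∣ listPoly N h * listPoly N g - 1) :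
    Polynomial.X ^ min (2 * g.length) h.length ∣ listPoly N h *
      listPoly N (linc N 2 1 g (mulCoeffs N (mulCoeffs N g g) (h.take (min (2 * g.length) h.length))) (min (2 * g.length) h.length)) - 1 := by
  set k2 := min (2 * g.length) h.length with hk2
  set c := mulCoeffs N (mulCoeffs N g g) (h.take k2) with hc
  rcases Nat.eq_zero_or_pos k2 with hz | hpos
  · rw [hz, pow_zero]; exact one_dvd _
  have hlen : k2 ≤ c.length := by
    rw [hc, length_mulCoeffs, length_mulCoeffs, List.length_take]; omega
  have hcN : ∀ x ∈ c.take k2, x < N := fun x hx => lt_of_mem_mulCoeffs hN (List.mem_of_mem_take hx)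
  have hvl : (c.take k2).length = k2 := by rw [List.length_take]; omega
  have key : ∀ vs : List ℕ, (∀ x ∈ vs, x < N) →
      listPoly N (linc N 2 1 g vs vs.length) = ptrunc vs.length (2 * listPoly N g - listPoly N vs) := fun vs hvs => by
    rw [listPoly_linc hvs, Nat.cast_ofNat]
  have e1 : listPoly N (linc N 2 1 g c k2) = ptrunc k2 (2 * listPoly N g - listPoly N h * listPoly N g ^ 2) := by
    have := key (c.take k2) hcN
    rw [hvl] at this
    rw [linc_take, this, listPoly_take, hc, listPoly_mulCoeffs hN (by rw [length_mulCoeffs]; omega) (by rw [List.length_take]; omega),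
      listPoly_mulCoeffs hN (by omega) (by omega), listPoly_take, ptrunc_sub, ptrunc_sub, ptrunc_ptrunc, ptrunc_mul_right]
    congr 2; ring
  have e2 := X_pow_dvd_sub_ptrunc k2 (2 * listPoly N g - listPoly N h * listPoly N g ^ 2)
  rw [← e1] at e2
  have e3 := X_pow_dvd_of_le (show k2 ≤ 2 * g.length from Nat.min_le_left _ _) (newton_step hinv)
  have := dvd_sub e3 (X_pow_dvd_mul_sub_mul (listPoly N h) e2)
  rwa [show listPoly N h * (2 * listPoly N g - listPoly N h * listPoly N g ^ 2) - 1 -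
      (listPoly N h * (2 * listPoly N g - listPoly N h * listPoly N g ^ 2) - listPoly N h * listPoly N (linc N 2 1 g c k2)) =
      listPoly N h * listPoly N (linc N 2 1 g c k2) - 1 by ring] at this

/-- **Correctness of the division scheme on coefficient lists** (von zur Gathen–Gerhard 2013,
Algorithm 9.5 / Theorem 9.6, in the square case `|A| = 2d`, `|B| = d + 1`): with `G` an inverse
of `rev_d b` modulo `x^d`, the list
`lin1 (A, (rev ((rev A mod x^d) · G mod x^d)) · B)` of length `d` is the coefficient list of
`a mod b`. [folklore] -/
theorem div_remainder_eq {N : ℕ} (hN : 1 < N) {A B G : List ℕ} {d : ℕ} (hd : 1 ≤ d) (hA : A.length = 2 * d) (hB : B.length = d + 1)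
    (hlast : B.getLast? = some 1) (hGl : G.length = d)
    (hG : Polynomial.X ^ d ∣ listPoly N ((B.reverse).take d) * listPoly N G - 1) :
    linc N 1 1 A (mulCoeffs N (((mulCoeffs N ((A.reverse).take d) G).take d).reverse) B) d =
      coeffList N d (listPoly N A %ₘ listPoly N B) := by
  haveI : Fact (1 < N) := ⟨hN⟩
  obtain ⟨hmon, hdeg⟩ := monic_listPoly_of_getLast hN hB hlast
  set a := listPoly N A with ha
  set b := listPoly N B with hb
  have han : a.natDegree ≤ 2 * d - 1 := by
    have := natDegree_listPoly_lt (N := N) (l := A) (by omega); rw [hA] at this; simp only [ha]; omega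
  -- the approximate inverse of the reversed divisor
  have hG' : Polynomial.X ^ (2 * d - 1 - d + 1) ∣ reflect d b * listPoly N G - 1 := by
    rw [show 2 * d - 1 - d + 1 = d by omega]
    have e1 : listPoly N ((B.reverse).take d) = ptrunc d (reflect d b) := by
      rw [listPoly_take, listPoly_reverse, hB, Nat.add_sub_cancel]
    rw [e1] at hG
    have e2 := X_pow_dvd_mul_sub_mul (listPoly N G) (X_pow_dvd_sub_ptrunc d (reflect d b))
    have := dvd_add hG e2
    rwa [show ptrunc d (reflect d b) * listPoly N G - 1 + (listPoly N G * reflect d b - listPoly N G * ptrunc d (reflect d b)) =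
      reflect d b * listPoly N G - 1 by ring] at this
  -- the reversed quotient
  have hq := ptrunc_reflect_mul_inv (a := a) hmon hdeg hd han (by omega) hG'
  rw [show 2 * d - 1 - d + 1 = d by omega, show 2 * d - 1 - d = d - 1 by omega] at hq
  have hRAl : ((A.reverse).take d).length = d := by rw [List.length_take, List.length_reverse]; omega
  have hC1l : (mulCoeffs N ((A.reverse).take d) G).length = 2 * d - 1 := by rw [length_mulCoeffs, hRAl, hGl]; omega
  have eQrev : listPoly N ((mulCoeffs N ((A.reverse).take d) G).take d) = reflect (d - 1) (a /ₘ b) := by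
    rw [listPoly_take, listPoly_mulCoeffs hN (by omega) (by omega), listPoly_take, listPoly_reverse, hA, ptrunc_mul_left, hq]
  have hQl : (((mulCoeffs N ((A.reverse).take d) G).take d).reverse).length = d := by
    rw [List.length_reverse, List.length_take, hC1l]; omega
  have eQ : listPoly N (((mulCoeffs N ((A.reverse).take d) G).take d).reverse) = a /ₘ b := by
    rw [listPoly_reverse, List.length_take, hC1l, show min d (2 * d - 1) - 1 = d - 1 by omega, eQrev, reflect_reflect]
  -- the remainder
  have hC2l : (mulCoeffs N (((mulCoeffs N ((A.reverse).take d) G).take d).reverse) B).length = 2 * d := by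
    rw [length_mulCoeffs, hQl, hB]; omega
  have hC2N : ∀ x ∈ (mulCoeffs N (((mulCoeffs N ((A.reverse).take d) G).take d).reverse) B).take d, x < N :=
    fun x hx => lt_of_mem_mulCoeffs hN (List.mem_of_mem_take hx)
  have hr : (a %ₘ b).natDegree < d := by
    have hb1 : b ≠ 1 := by rintro h1; rw [h1] at hdeg; simp at hdeg; omega
    have := natDegree_modByMonic_lt a hmon hb1; omega
  have eR : listPoly N (linc N 1 1 A (mulCoeffs N (((mulCoeffs N ((A.reverse).take d) G).take d).reverse) B) d) = a %ₘ b := by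
    have key := listPoly_linc' (N := N) (x := 1) (us := A) hC2N
    rw [List.length_take, hC2l, show min d (2 * d) = d by omega] at key
    rw [linc_take, key, listPoly_take, listPoly_mulCoeffs hN (by omega) (by omega), eQ, Nat.cast_one, one_mul, ptrunc_sub, ptrunc_ptrunc,
      ← ptrunc_sub, show a - a /ₘ b * b = a %ₘ b by rw [sub_eq_iff_eq_add, mul_comm]; exact (modByMonic_add_div a b).symm]
    exact ptrunc_eq_self fun i hi => coeff_eq_zero_of_natDegree_lt (by omega)
  refine listPoly_injective (N := N) (by rw [length_linc, length_coeffList]) (fun x hx => lt_of_mem_linc (by omega) hx)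
    (fun x hx => lt_of_mem_coeffList hN hx) ?_
  rw [eR, listPoly_coeffList hN ((Polynomial.degree_le_natDegree).trans_lt (by exact_mod_cast hr))]


end Lin

/-! ### Normal forms with opaque scratch

For symbolic execution of long routines it is convenient to have each sub-routine as one
rewrite rule `eval R σ = ⟨…⟩` in which the registers it is *specified* on are explicit and its
scratch registers refer back to `eval R σ` itself. -/

section NormalForms

/-- The final transfer scalar of `revP` (canonical witness). [folklore] -/
def revPx (v w : V) (x cnt : S) (σ : NState S V O) : ℕ := ((revP v w x cnt : NCom S V O E).eval 𝓔 σ).sc x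

/-- **`revP` in closed form** (the transfer scalar opaque). [folklore] -/
theorem revP_eq {v w : V} (hvw : v ≠ w) (x cnt : S) (σ : NState S V O) (h : σ.sc cnt ≤ (σ.vi v).length) :
    (revP v w x cnt : NCom S V O E).eval 𝓔 σ =
      { sc := Function.update σ.sc x (revPx 𝓔 v w x cnt σ),
        vi := Function.update (Function.update σ.vi v ((σ.vi v).drop (σ.sc cnt))) w (((σ.vi v).take (σ.sc cnt)).reverse ++ σ.vi w),
        vo := σ.vo, peak := σ.peak, steps := σ.steps + 3 * σ.sc cnt + 1 } := by
  obtain ⟨h1, h2, h3, h4, h5, h6, h7⟩ := revP_spec 𝓔 hvw x cnt σ h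
  refine NState.ext ?_ ?_ h5 h6 h7
  · funext s; dsimp only; by_cases hs : s = x
    · subst hs; simp [revPx]
    · rw [Function.update_of_ne hs]; exact h3 s hs
  · funext u; dsimp only; by_cases hu : u = w
    · subst hu; simpa using h2
    · rw [Function.update_of_ne hu]
      by_cases hu' : u = v
      · subst hu'; simpa using h1
      · rw [Function.update_of_ne hu']; exact h4 u hu' hu

variable (ρl : LinS ↪ S)

/-- The scalar bank after `linP` (canonical witness for the scratch registers). [folklore] -/
def linPsc (u v : V) (o : O) (σ : NState S V O) : S → ℕ := ((linP ρl u v o : NCom S V O E).eval 𝓔 σ).sc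

/-- The peak after `linP` (canonical witness). [folklore] -/
def linPpeak (u v : V) (o : O) (σ : NState S V O) : ℕ := ((linP ρl u v o : NCom S V O E).eval 𝓔 σ).peak

/-- **`linP` in closed form** (scratch `a b y q r` opaque; `cnt ≤ |v|`, `u ≠ v`). [folklore] -/
theorem linP_eq (u v : V) (o : O) (huv : u ≠ v) (σ : NState S V O) (h : σ.sc (ρl .cnt) ≤ (σ.vi v).length) :
    (linP ρl u v o : NCom S V O E).eval 𝓔 σ =
      { sc := fun s => if s = ρl .a then linPsc 𝓔 ρl u v o σ s else if s = ρl .b then linPsc 𝓔 ρl u v o σ s else if s = ρl .y then linPsc 𝓔 ρl u v o σ s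
          else if s = ρl .q then linPsc 𝓔 ρl u v o σ s else if s = ρl .r then linPsc 𝓔 ρl u v o σ s else σ.sc s,
        vi := Function.update (Function.update σ.vi u ((σ.vi u).drop (σ.sc (ρl .cnt)))) v ((σ.vi v).drop (σ.sc (ρl .cnt))),
        vo := Function.update σ.vo o (σ.vo o ++ linc (σ.sc (ρl .n)) (σ.sc (ρl .cu)) (σ.sc (ρl .cv)) (σ.vi u) (σ.vi v) (σ.sc (ρl .cnt))),
        peak := linPpeak 𝓔 ρl u v o σ, steps := σ.steps + 9 * σ.sc (ρl .cnt) + 1 } := by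
  obtain ⟨h1, h2, h3, h4, h5, h6, h7, -, h9⟩ := linP_spec 𝓔 ρl u v o huv σ (U := 0 ⊔ (σ.vi u).foldr max 0) (fun a ha => le_sup_of_le_right (le_foldr_max ha)) h
  refine NState.ext ?_ ?_ ?_ rfl h9
  · funext s
    dsimp only
    split_ifs with s1 s2 s3 s4 s5
    · rfl
    · rfl
    · rfl
    · rfl
    · rfl
    · by_cases hs' : ∃ i, s = ρl i
      · obtain ⟨i, rfl⟩ := hs'
        exact h4 i (fun h => s1 (by rw [h])) (fun h => s2 (by rw [h])) (fun h => s3 (by rw [h])) (fun h => s4 (by rw [h])) (fun h => s5 (by rw [h]))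
      · simp only [not_exists] at hs'
        exact h5 s hs'
  · funext w; dsimp only; by_cases hw : w = v
    · subst hw; simpa using h2
    · rw [Function.update_of_ne hw]
      by_cases hw' : w = u
      · subst hw'; simpa using h1
      · rw [Function.update_of_ne hw']; exact h6 w hw' hw
  · funext p; dsimp only; by_cases hp : p = o
    · subst hp; simpa using h3
    · rw [Function.update_of_ne hp]; exact h7 p hp

variable {𝓔} (M : Multiplier 𝓔) (ρ : PMulS ↪ S) (ν : PMulV ↪ V) (acc : O)

/-- All entries reduced modulo `N` — as one atomic proposition, so that `simp` can discharge
it from a hypothesis of the same shape during symbolic execution. [folklore] -/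
def Reduced (N : ℕ) (l : List ℕ) : Prop := ∀ x ∈ l, x < N

/-- The scalar bank after `pmulP` (canonical witness for the scratch registers). [folklore] -/
def pmulPsc (σ : NState S V O) : S → ℕ := ((pmulP M ρ ν acc : NCom S V O E).eval 𝓔 σ).sc

/-- The peak after `pmulP` (canonical witness). [folklore] -/
def pmulPpeak (σ : NState S V O) : ℕ := ((pmulP M ρ ν acc : NCom S V O E).eval 𝓔 σ).peak

/-- The step count after `pmulP` (canonical witness). [folklore] -/
def pmulPsteps (σ : NState S V O) : ℕ := ((pmulP M ρ ν acc : NCom S V O E).eval 𝓔 σ).steps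

/-- **`pmulP` in closed form** (scratch scalars opaque; hypotheses of `pmulP_spec`). [folklore] -/
theorem pmulP_eq (σ : NState S V O) (hN : 1 < σ.sc (ρ .n))
    (hla : σ.sc (ρ .la) = (σ.vi (ν .A)).length) (hlb : σ.sc (ρ .lb) = (σ.vi (ν .B)).length)
    (ha : 0 < (σ.vi (ν .A)).length) (hb : 0 < (σ.vi (ν .B)).length)
    (hBN : Reduced (σ.sc (ρ .n)) (σ.vi (ν .B)))
    (hF : σ.vi (ν .F) = []) (hG : σ.vi (ν .G) = []) (hC : σ.vi (ν .C) = []) (hacc : σ.vo acc = []) :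
    (pmulP M ρ ν acc : NCom S V O E).eval 𝓔 σ =
      { sc := fun s => if s = ρ .n then σ.sc s else if s = ρ .la then σ.sc s else if s = ρ .lb then σ.sc s
          else if ∃ i, s = ρ i then pmulPsc M ρ ν acc σ s else σ.sc s,
        vi := fun w => if w = ν .C then mulCoeffs (σ.sc (ρ .n)) (σ.vi (ν .A)) (σ.vi (ν .B)) else if ∃ i, w = ν i then [] else σ.vi w,
        vo := σ.vo, peak := pmulPpeak M ρ ν acc σ, steps := pmulPsteps M ρ ν acc σ } := by
  obtain ⟨p1, pA, pB, pF, pG, pH, pw, pvo, pn, pla, plb, pr, -, -⟩ := pmulP_spec (𝓔 := 𝓔) M ρ ν acc σ hN hla hlb ha hb hBN hF hG hC hacc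
  refine NState.ext ?_ ?_ pvo rfl rfl
  · funext s
    dsimp only
    split_ifs with h1 h2 h3 h4
    · subst h1; exact pn
    · subst h2; exact pla
    · subst h3; exact plb
    · rfl
    · simp only [not_exists] at h4; exact pr s h4
  · funext w
    dsimp only
    split_ifs with h1 h2
    · subst h1; exact p1
    · obtain ⟨i, rfl⟩ := h2
      cases i
      exacts [pA, pB, pF, pG, pH, absurd rfl h1]
    · simp only [not_exists] at h2; exact pw w h2

end NormalForms

/-! ### Newton inversion -/

/-- Scalar roles of `invP`: those of `pmulP` and `linP`, the target length `m1`, the current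
and next lengths `k, k2`, the round count `t`, scratch `tmp`, the constant `one`. [folklore] -/
inductive InvS where
  | pm (i : PMulS) | ln (i : LinS) | m1 | k | k2 | t | tmp | one
  deriving DecidableEq

/-- Queue roles of `invP`: those of `pmulP`, the reversed divisor `RB`, the inverse `G`.
[folklore] -/
inductive InvV where
  | pv (i : PMulV) | RB | G
  deriving DecidableEq

/-- Accumulator roles of `invP`. [folklore] -/
inductive InvO where
  | acc | acc2 | accL
  deriving DecidableEq

/-- The scalar roles of the inner multiplication. [folklore] -/
def InvS.pmE : PMulS ↪ InvS := ⟨InvS.pm, fun _ _ h => InvS.pm.inj h⟩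

/-- The scalar roles of the inner linear combination. [folklore] -/
def InvS.lnE : LinS ↪ InvS := ⟨InvS.ln, fun _ _ h => InvS.ln.inj h⟩

/-- The queue roles of the inner multiplication. [folklore] -/
def InvV.pvE : PMulV ↪ InvV := ⟨InvV.pv, fun _ _ h => InvV.pv.inj h⟩

/-- Unfolding the embedding. [folklore] -/
@[simp] theorem InvS.pmE_apply (i : PMulS) : InvS.pmE i = .pm i := rfl
/-- Unfolding the embedding. [folklore] -/
@[simp] theorem InvS.lnE_apply (i : LinS) : InvS.lnE i = .ln i := rfl
/-- Unfolding the embedding. [folklore] -/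
@[simp] theorem InvV.pvE_apply (i : PMulV) : InvV.pvE i = .pv i := rfl

section Inv

variable {𝓔} (M : Multiplier 𝓔) (ρ : InvS ↪ S) (ν : InvV ↪ V) (ω : InvO ↪ O)

local notation "ρp" => (InvS.pmE.trans ρ)
local notation "ρl" => (InvS.lnE.trans ρ)
local notation "νp" => (InvV.pvE.trans ν)

/-- Stage 1 of a Newton round: `k2 := min (2k, m1)`; `A := g`, `B := g` (keeping `G = g`).
[folklore] -/
def invS1 : NCom S V O E :=
  add (ρ .k2) (ρ .k) (ρ .k) ;ₙ sub (ρ .tmp) (ρ .k2) (ρ .m1) ;ₙ sub (ρ .k2) (ρ .k2) (ρ .tmp) ;ₙ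
  teeN (ν .G) (ω .acc) (ω .acc2) (ρ (.pm .x)) (ρ .k) ;ₙ pour (ω .acc) (ν (.pv .A)) ;ₙ pour (ω .acc2) (ν .G) ;ₙ
  teeN (ν .G) (ω .acc) (ω .acc2) (ρ (.pm .x)) (ρ .k) ;ₙ pour (ω .acc) (ν (.pv .B)) ;ₙ pour (ω .acc2) (ν .G) ;ₙ
  mov (ρ (.pm .la)) (ρ .k) ;ₙ mov (ρ (.pm .lb)) (ρ .k)

/-- Stage 3 of a Newton round: `A := g²` (from `C`), `B := h mod x^{k2}` (keeping `RB = h`).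
[folklore] -/
def invS3 : NCom S V O E :=
  add (ρ .tmp) (ρ .k) (ρ .k) ;ₙ sub (ρ .tmp) (ρ .tmp) (ρ .one) ;ₙ moveN (ν (.pv .C)) (ω .acc) (ρ (.pm .x)) (ρ .tmp) ;ₙ
  pour (ω .acc) (ν (.pv .A)) ;ₙ
  teeN (ν .RB) (ω .acc) (ω .acc2) (ρ (.pm .x)) (ρ .k2) ;ₙ pour (ω .acc) (ν (.pv .B)) ;ₙ pour (ω .acc2) (ν .RB) ;ₙ
  mov (ρ (.pm .la)) (ρ .tmp) ;ₙ mov (ρ (.pm .lb)) (ρ .k2) ;ₙ mov (ρ (.ln .cnt)) (ρ .k2)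

/-- Stage 5 of a Newton round, after the linear combination: `C` cleared, `G := g'`,
`k := k2`. [folklore] -/
def invS5 : NCom S V O E :=
  clearV (ν (.pv .C)) ;ₙ pour (ω .accL) (ν .G) ;ₙ mov (ρ .k) (ρ .k2)

/-- One Newton round `g ↦ 2 g - h g² (mod x^{min (2k, m1)})`. [von zur Gathen–Gerhard 2013,
Algorithm 9.3] [folklore] -/
def invBody : NCom S V O E :=
  invS1 ρ ν ω ;ₙ (pmulP M ρp νp (ω .acc) ;ₙ (invS3 ρ ν ω ;ₙ (pmulP M ρp νp (ω .acc) ;ₙ (linP ρl (ν .G) (ν (.pv .C)) (ω .accL) ;ₙ invS5 ρ ν ω))))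

/-- Initialisation: constants, `G := [1]`, `k := 1`, `t := size (m1 - 1)` rounds. [folklore] -/
def invInit : NCom S V O E :=
  setc (ρ .one) 1 ;ₙ setc (ρ (.ln .cu)) 2 ;ₙ setc (ρ (.ln .cv)) 1 ;ₙ mov (ρ (.ln .n)) (ρ (.pm .n)) ;ₙ
  clearV (ν .G) ;ₙ push (ν .G) (ρ .one) ;ₙ setc (ρ .k) 1 ;ₙ sub (ρ .tmp) (ρ .m1) (ρ .one) ;ₙ sizeOf (ρ .t) (ρ .tmp)

/-- **Newton inversion** `invP`: from `RB = h` (`|h| = m1 ≥ 1`, `h₀ = 1`, reduced entries)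
compute `G = g` with `|g| = m1` and `h g ≡ 1 (mod x^{m1})`. [von zur Gathen–Gerhard 2013,
Algorithm 9.3, Theorem 9.4] [folklore] -/
def invP : NCom S V O E := invInit ρ ν ;ₙ times (ρ .t) (invBody M ρ ν ω)

omit [DecidableEq S] [DecidableEq V] [DecidableEq O] in
/-- The stages have no extension calls. [folklore] -/
theorem invS_noExt : (invS1 ρ ν ω : NCom S V O E).noExt ∧ (invS3 ρ ν ω : NCom S V O E).noExt ∧ (invS5 ρ ν ω : NCom S V O E).noExt ∧
    (invInit ρ ν : NCom S V O E).noExt := by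
  simp [invS1, invS3, invS5, invInit, noExt, teeN_noExt, moveN_noExt]

/-- The invariant of the Newton loop. [folklore] -/
structure InvInv (σ : NState S V O) (h g : List ℕ) : Prop where
  hN : 1 < σ.sc (ρ (.pm .n))
  hodd : Odd (σ.sc (ρ (.pm .n)))
  hln : σ.sc (ρ (.ln .n)) = σ.sc (ρ (.pm .n))
  hcu : σ.sc (ρ (.ln .cu)) = 2
  hcv : σ.sc (ρ (.ln .cv)) = 1
  hone : σ.sc (ρ .one) = 1
  hm1 : σ.sc (ρ .m1) = h.length
  hk : σ.sc (ρ .k) = g.length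
  hk1 : 1 ≤ g.length
  hkm : g.length ≤ h.length
  hRB : σ.vi (ν .RB) = h
  hG : σ.vi (ν .G) = g
  hhN : ∀ x ∈ h, x < σ.sc (ρ (.pm .n))
  hgN : ∀ x ∈ g, x < σ.sc (ρ (.pm .n))
  hinv : Polynomial.X ^ g.length ∣ listPoly (σ.sc (ρ (.pm .n))) h * listPoly (σ.sc (ρ (.pm .n))) g - 1
  hA : σ.vi (ν (.pv .A)) = []
  hB : σ.vi (ν (.pv .B)) = []
  hF : σ.vi (ν (.pv .F)) = []
  hGG : σ.vi (ν (.pv .G)) = []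
  hH : σ.vi (ν (.pv .H)) = []
  hC : σ.vi (ν (.pv .C)) = []
  hacc : σ.vo (ω .acc) = []
  hacc2 : σ.vo (ω .acc2) = []
  haccL : σ.vo (ω .accL) = []

set_option maxHeartbeats 2000000 in
set_option linter.unusedSimpArgs false in -- one uniform simp set drives the symbolic execution of every stage
/-- **One Newton round.** [von zur Gathen–Gerhard 2013, Algorithm 9.3] [folklore] -/
theorem invBody_spec (σ : NState S V O) (h g : List ℕ) (hI : InvInv ρ ν ω σ h g) :
    let k2 := min (2 * g.length) h.length
    let g' := linc (σ.sc (ρ (.pm .n))) 2 1 g (mulCoeffs (σ.sc (ρ (.pm .n))) (mulCoeffs (σ.sc (ρ (.pm .n))) g g) (h.take k2)) k2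
    let τ := (invBody M ρ ν ω : NCom S V O E).eval 𝓔 σ
    InvInv ρ ν ω τ h g' ∧ (∀ w, (∀ i, w ≠ ν i) → τ.vi w = σ.vi w) ∧ (∀ p, (∀ i, p ≠ ω i) → τ.vo p = σ.vo p) ∧
      (∀ r, (∀ i, r ≠ ρ i) → τ.sc r = σ.sc r) ∧ τ.sc (ρ .t) = σ.sc (ρ .t) ∧ τ.sc (ρ (.pm .n)) = σ.sc (ρ (.pm .n)) ∧
      τ.peak ≤ max σ.peak (max (3 * σ.sc (ρ (.pm .n))) (8 * h.length)) ∧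
      τ.steps ≤ σ.steps + 200 * h.length + M.cost (4 * h.length) + M.cost (6 * h.length) + 100 ∧
      (invBody M ρ ν ω : NCom S V O E).extOK 𝓔 σ := by
  intro k2 g' τ
  obtain ⟨hN, hodd, hln, hcu, hcv, hone, hm1, hk, hk1, hkm, hRB, hG, hhN, hgN, hinv, hA, hB, hF, hGG, hH, hC, hacc, hacc2, haccL⟩ := hI
  have ho : ω .acc ≠ ω .acc2 := by simp
  have hk0 : 0 < g.length := hk1
  have hT : g.length + g.length - (g.length + g.length - h.length) = k2 := by simp only [k2]; omega
  have hgN' : Reduced (σ.sc (ρ (.pm .n))) g := hgN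
  have hggN : Reduced (σ.sc (ρ (.pm .n))) (mulCoeffs (σ.sc (ρ (.pm .n))) g g) := fun x hx => lt_of_mem_mulCoeffs hN hx
  have hhN' : Reduced (σ.sc (ρ (.pm .n))) (h.take (g.length + g.length - (g.length + g.length - h.length))) := fun x hx => hhN x (List.mem_of_mem_take hx)
  have htake1 : (mulCoeffs (σ.sc (ρ (.pm .n))) g g).take (g.length + g.length - 1) = mulCoeffs (σ.sc (ρ (.pm .n))) g g :=
    List.take_of_length_le (by rw [length_mulCoeffs])
  have hdrop1 : (mulCoeffs (σ.sc (ρ (.pm .n))) g g).drop (g.length + g.length - 1) = [] :=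
    List.drop_of_length_le (by rw [length_mulCoeffs])
  have hminT : min (g.length + g.length - (g.length + g.length - h.length)) h.length = g.length + g.length - (g.length + g.length - h.length) :=
    Nat.min_eq_left (by omega)
  have hT0 : 0 < g.length + g.length - (g.length + g.length - h.length) := by omega
  have hTk : g.length ≤ g.length + g.length - (g.length + g.length - h.length) := by omega
  have hTh : g.length + g.length - (g.length + g.length - h.length) ≤ h.length := by omega
  have hmul : 2 * (g.length + g.length - 1 + (g.length + g.length - (g.length + g.length - h.length))) ≤ 8 * h.length := by omega
  have h6 : 2 * (g.length + g.length - 1 + (g.length + g.length - (g.length + g.length - h.length))) ≤ 6 * h.length := by omega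
  have h4 : 4 * g.length ≤ 4 * h.length := by omega
  have hggl' : 0 < g.length + g.length - 1 := by omega
  have hCl' : g.length + g.length - (g.length + g.length - h.length) ≤ g.length + g.length - 1 + (g.length + g.length - (g.length + g.length - h.length)) - 1 := by
    omega
  have huv : ν .G ≠ ν (.pv .C) := by simp
  -- the stage states, made opaque
  set X1 := (invS1 ρ ν ω : NCom S V O E).eval 𝓔 σ with hX1
  set Y1 := (pmulP M (InvS.pmE.trans ρ) (InvV.pvE.trans ν) (ω .acc) : NCom S V O E).eval 𝓔 X1 with hY1
  set X2 := (invS3 ρ ν ω : NCom S V O E).eval 𝓔 Y1 with hX2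
  set Y2 := (pmulP M (InvS.pmE.trans ρ) (InvV.pvE.trans ν) (ω .acc) : NCom S V O E).eval 𝓔 X2 with hY2
  have hτ : τ = (invS5 ρ ν ω : NCom S V O E).eval 𝓔 ((linP (InvS.lnE.trans ρ) (ν .G) (ν (.pv .C)) (ω .accL) : NCom S V O E).eval 𝓔 Y2) := rfl
  clear_value X1 Y1 X2 Y2 τ
  -- stage 1
  have a_w : ∀ w, (∀ i, w ≠ ν i) → X1.vi w = σ.vi w := fun w hw => by simp only [hw, hX1, hk, hG, hA, hB, hF, hGG, hC, hH, hRB, hacc, hacc2, haccL, hm1, hone, hln, hcu, hcv, teeN_eq 𝓔 _ ho, moveN_eq' 𝓔, invS1, invS3, invS5, invInit, eval_seq, eval,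
      NState.sc_bump, NState.sc_setSc, NState.sc_setVi, NState.sc_setVo, NState.vi_bump,
      NState.vi_setSc, NState.vi_setVi, NState.vi_setVo, NState.vo_bump, NState.vo_setSc, NState.vo_setVi, NState.vo_setVo,
      NState.steps_bump, NState.steps_setSc, NState.steps_setVi, NState.steps_setVo, NState.peak_bump, NState.peak_setSc, NState.peak_setVi,
      NState.peak_setVo, Function.update_apply, EmbeddingLike.apply_eq_iff_eq, reduceCtorEq, InvV.pv.injEq, InvS.pm.injEq, InvS.ln.injEq,
      ite_true, ite_false, not_false_eq_true, implies_true, Nat.max_zero, Nat.zero_max,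
      List.take_length, List.drop_length, List.nil_append, List.append_nil, le_refl, List.take_append_drop, List.length_nil, List.length_append,
      tsub_tsub_le]
  have a_p : ∀ p, (∀ i, p ≠ ω i) → X1.vo p = σ.vo p := fun p hp => by simp only [hp, hX1, hk, hG, hA, hB, hF, hGG, hC, hH, hRB, hacc, hacc2, haccL, hm1, hone, hln, hcu, hcv, teeN_eq 𝓔 _ ho, moveN_eq' 𝓔, invS1, invS3, invS5, invInit, eval_seq, eval,
      NState.sc_bump, NState.sc_setSc, NState.sc_setVi, NState.sc_setVo, NState.vi_bump,
      NState.vi_setSc, NState.vi_setVi, NState.vi_setVo, NState.vo_bump, NState.vo_setSc, NState.vo_setVi, NState.vo_setVo,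
      NState.steps_bump, NState.steps_setSc, NState.steps_setVi, NState.steps_setVo, NState.peak_bump, NState.peak_setSc, NState.peak_setVi,
      NState.peak_setVo, Function.update_apply, EmbeddingLike.apply_eq_iff_eq, reduceCtorEq, InvV.pv.injEq, InvS.pm.injEq, InvS.ln.injEq,
      ite_true, ite_false, not_false_eq_true, implies_true, Nat.max_zero, Nat.zero_max,
      List.take_length, List.drop_length, List.nil_append, List.append_nil, le_refl, List.take_append_drop, List.length_nil, List.length_append,
      tsub_tsub_le]
  have a_r : ∀ r, (∀ i, r ≠ ρ i) → X1.sc r = σ.sc r := fun r hr => by simp only [hr, hX1, hk, hG, hA, hB, hF, hGG, hC, hH, hRB, hacc, hacc2, haccL, hm1, hone, hln, hcu, hcv, teeN_eq 𝓔 _ ho, moveN_eq' 𝓔, invS1, invS3, invS5, invInit, eval_seq, eval,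
      NState.sc_bump, NState.sc_setSc, NState.sc_setVi, NState.sc_setVo, NState.vi_bump,
      NState.vi_setSc, NState.vi_setVi, NState.vi_setVo, NState.vo_bump, NState.vo_setSc, NState.vo_setVi, NState.vo_setVo,
      NState.steps_bump, NState.steps_setSc, NState.steps_setVi, NState.steps_setVo, NState.peak_bump, NState.peak_setSc, NState.peak_setVi,
      NState.peak_setVo, Function.update_apply, EmbeddingLike.apply_eq_iff_eq, reduceCtorEq, InvV.pv.injEq, InvS.pm.injEq, InvS.ln.injEq,
      ite_true, ite_false, not_false_eq_true, implies_true, Nat.max_zero, Nat.zero_max,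
      List.take_length, List.drop_length, List.nil_append, List.append_nil, le_refl, List.take_append_drop, List.length_nil, List.length_append,
      tsub_tsub_le]
  obtain ⟨aA, aB, aG, aRB, aC, aF, aGG, aH, aacc, aacc2, aaccL, ak2, ala, alb, an, aln, acu, acv, aone, am1, ak, at', acnt, apk, ast⟩ :
      X1.vi (ν (.pv .A)) = g ∧
      X1.vi (ν (.pv .B)) = g ∧
      X1.vi (ν .G) = g ∧
      X1.vi (ν .RB) = h ∧
      X1.vi (ν (.pv .C)) = [] ∧
      X1.vi (ν (.pv .F)) = [] ∧
      X1.vi (ν (.pv .G)) = [] ∧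
      X1.vi (ν (.pv .H)) = [] ∧
      X1.vo (ω .acc) = [] ∧
      X1.vo (ω .acc2) = [] ∧
      X1.vo (ω .accL) = [] ∧
      X1.sc (ρ .k2) = g.length + g.length - (g.length + g.length - h.length) ∧
      X1.sc (ρ (.pm .la)) = g.length ∧
      X1.sc (ρ (.pm .lb)) = g.length ∧
      X1.sc (ρ (.pm .n)) = σ.sc (ρ (.pm .n)) ∧
      X1.sc (ρ (.ln .n)) = σ.sc (ρ (.pm .n)) ∧
      X1.sc (ρ (.ln .cu)) = 2 ∧
      X1.sc (ρ (.ln .cv)) = 1 ∧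
      X1.sc (ρ .one) = 1 ∧
      X1.sc (ρ .m1) = h.length ∧
      X1.sc (ρ .k) = g.length ∧
      X1.sc (ρ .t) = σ.sc (ρ .t) ∧
      X1.sc (ρ (.ln .cnt)) = σ.sc (ρ (.ln .cnt)) ∧
      X1.peak = max σ.peak (g.length + g.length) ∧
      X1.steps = σ.steps + 12 * g.length + 11 := by
    refine ⟨?_, ?_, ?_, ?_, ?_, ?_, ?_, ?_, ?_, ?_, ?_, ?_, ?_, ?_, ?_, ?_, ?_, ?_, ?_, ?_, ?_, ?_, ?_, ?_, ?_⟩ <;>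
      simp only [hX1, hk, hG, hA, hB, hF, hGG, hC, hH, hRB, hacc, hacc2, haccL, hm1, hone, hln, hcu, hcv, teeN_eq 𝓔 _ ho, moveN_eq' 𝓔, invS1, invS3, invS5, invInit, eval_seq, eval,
      NState.sc_bump, NState.sc_setSc, NState.sc_setVi, NState.sc_setVo, NState.vi_bump,
      NState.vi_setSc, NState.vi_setVi, NState.vi_setVo, NState.vo_bump, NState.vo_setSc, NState.vo_setVi, NState.vo_setVo,
      NState.steps_bump, NState.steps_setSc, NState.steps_setVi, NState.steps_setVo, NState.peak_bump, NState.peak_setSc, NState.peak_setVi,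
      NState.peak_setVo, Function.update_apply, EmbeddingLike.apply_eq_iff_eq, reduceCtorEq, InvV.pv.injEq, InvS.pm.injEq, InvS.ln.injEq,
      ite_true, ite_false, not_false_eq_true, implies_true, Nat.max_zero, Nat.zero_max,
      List.take_length, List.drop_length, List.nil_append, List.append_nil, le_refl, List.take_append_drop, List.length_nil, List.length_append,
      tsub_tsub_le]
    omega
  -- the square
  obtain ⟨p1, pA, pB, pF, pG, pH, pw, pvo, pn, pla, plb, pr, ppk, pst⟩ :=
    pmulP_spec (𝓔 := 𝓔) M (InvS.pmE.trans ρ) (InvV.pvE.trans ν) (ω .acc) X1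
      (by show 1 < X1.sc (ρ (.pm .n)); rw [an]; exact hN)
      (by show X1.sc (ρ (.pm .la)) = (X1.vi (ν (.pv .A))).length; rw [ala, aA])
      (by show X1.sc (ρ (.pm .lb)) = (X1.vi (ν (.pv .B))).length; rw [alb, aB])
      (by show 0 < (X1.vi (ν (.pv .A))).length; rw [aA]; exact hk0) (by show 0 < (X1.vi (ν (.pv .B))).length; rw [aB]; exact hk0)
      (by show ∀ x ∈ X1.vi (ν (.pv .B)), x < X1.sc (ρ (.pm .n)); rw [aB, an]; exact hgN) aF aGG aC aacc
  rw [← hY1] at p1 pA pB pF pG pH pw pvo pn pla plb pr ppk pst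
  simp only [Function.Embedding.trans_apply, InvS.pmE_apply, InvV.pvE_apply, InvS.lnE_apply] at p1 pA pB pF pG pH pw pn pla plb pr ppk pst
  have yC : Y1.vi (ν (.pv .C)) = mulCoeffs (σ.sc (ρ (.pm .n))) g g := by rw [p1, an, aA, aB]
  have yA : Y1.vi (ν (.pv .A)) = [] := pA
  have yB : Y1.vi (ν (.pv .B)) = [] := pB
  have yF : Y1.vi (ν (.pv .F)) = [] := pF
  have yGG : Y1.vi (ν (.pv .G)) = [] := pG
  have yH : Y1.vi (ν (.pv .H)) = [] := pH
  have yv : ∀ w : InvV, (∀ i, w ≠ .pv i) → Y1.vi (ν w) = X1.vi (ν w) := fun w hw => pw _ (fun i => by simpa using hw i)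
  have yG : Y1.vi (ν .G) = g := (yv .G (by simp)).trans aG
  have yRB : Y1.vi (ν .RB) = h := (yv .RB (by simp)).trans aRB
  have yvo : Y1.vo = X1.vo := pvo
  have ys : ∀ r : InvS, (∀ i, r ≠ .pm i) → Y1.sc (ρ r) = X1.sc (ρ r) := fun r hr => pr _ (fun i => by simpa using hr i)
  have yn : Y1.sc (ρ (.pm .n)) = σ.sc (ρ (.pm .n)) := pn.trans an
  have yk : Y1.sc (ρ .k) = g.length := (ys .k (by simp)).trans ak
  have yk2 : Y1.sc (ρ .k2) = g.length + g.length - (g.length + g.length - h.length) := (ys .k2 (by simp)).trans ak2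
  have yone : Y1.sc (ρ .one) = 1 := (ys .one (by simp)).trans aone
  have ym1 : Y1.sc (ρ .m1) = h.length := (ys .m1 (by simp)).trans am1
  have yt : Y1.sc (ρ .t) = σ.sc (ρ .t) := (ys .t (by simp)).trans at'
  have yln : Y1.sc (ρ (.ln .n)) = σ.sc (ρ (.pm .n)) := (ys (.ln .n) (by simp)).trans aln
  have ycu : Y1.sc (ρ (.ln .cu)) = 2 := (ys (.ln .cu) (by simp)).trans acu
  have ycv : Y1.sc (ρ (.ln .cv)) = 1 := (ys (.ln .cv) (by simp)).trans acv
  have yacc : Y1.vo (ω .acc) = [] := by rw [yvo, aacc]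
  have yacc2 : Y1.vo (ω .acc2) = [] := by rw [yvo, aacc2]
  have yaccL : Y1.vo (ω .accL) = [] := by rw [yvo, aaccL]
  have ypk : Y1.peak ≤ max σ.peak (max (σ.sc (ρ (.pm .n))) (4 * g.length)) := by
    refine ppk.trans ?_
    rw [apk, an, ala, alb]
    refine max_le (max_le (le_max_left _ _) (le_max_of_le_right (le_max_of_le_right (by omega)))) (le_max_of_le_right (max_le (le_max_left _ _) (le_max_of_le_right (by omega))))
  have yst : Y1.steps ≤ σ.steps + 72 * g.length + M.cost (4 * g.length) + 41 := by
    refine pst.trans ?_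
    rw [ast, ala, alb, show 2 * (g.length + g.length) = 4 * g.length by ring]
    omega
  -- stage 3
  have b_w : ∀ w, (∀ i, w ≠ ν i) → X2.vi w = σ.vi w := fun w hw => by
    rw [← a_w w hw, ← pw w (fun i => hw (.pv i))]; simp only [hw, hX2, yC, yA, yB, yF, yGG, yH, yG, yRB, yn, yk, yk2, yone, ym1, yt, yln, ycu, ycv, yacc, yacc2, yaccL, htake1, hdrop1, hminT, length_mulCoeffs, List.length_take, teeN_eq 𝓔 _ ho, moveN_eq' 𝓔, invS1, invS3, invS5, invInit, eval_seq, eval,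
      NState.sc_bump, NState.sc_setSc, NState.sc_setVi, NState.sc_setVo, NState.vi_bump,
      NState.vi_setSc, NState.vi_setVi, NState.vi_setVo, NState.vo_bump, NState.vo_setSc, NState.vo_setVi, NState.vo_setVo,
      NState.steps_bump, NState.steps_setSc, NState.steps_setVi, NState.steps_setVo, NState.peak_bump, NState.peak_setSc, NState.peak_setVi,
      NState.peak_setVo, Function.update_apply, EmbeddingLike.apply_eq_iff_eq, reduceCtorEq, InvV.pv.injEq, InvS.pm.injEq, InvS.ln.injEq,
      ite_true, ite_false, not_false_eq_true, implies_true, Nat.max_zero, Nat.zero_max,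
      List.take_length, List.drop_length, List.nil_append, List.append_nil, le_refl, List.take_append_drop, List.length_nil, List.length_append,
      tsub_tsub_le]
  have b_p : ∀ p, (∀ i, p ≠ ω i) → X2.vo p = σ.vo p := fun p hp => by
    rw [← a_p p hp, ← yvo]; simp only [hp, hX2, yC, yA, yB, yF, yGG, yH, yG, yRB, yn, yk, yk2, yone, ym1, yt, yln, ycu, ycv, yacc, yacc2, yaccL, htake1, hdrop1, hminT, length_mulCoeffs, List.length_take, teeN_eq 𝓔 _ ho, moveN_eq' 𝓔, invS1, invS3, invS5, invInit, eval_seq, eval,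
      NState.sc_bump, NState.sc_setSc, NState.sc_setVi, NState.sc_setVo, NState.vi_bump,
      NState.vi_setSc, NState.vi_setVi, NState.vi_setVo, NState.vo_bump, NState.vo_setSc, NState.vo_setVi, NState.vo_setVo,
      NState.steps_bump, NState.steps_setSc, NState.steps_setVi, NState.steps_setVo, NState.peak_bump, NState.peak_setSc, NState.peak_setVi,
      NState.peak_setVo, Function.update_apply, EmbeddingLike.apply_eq_iff_eq, reduceCtorEq, InvV.pv.injEq, InvS.pm.injEq, InvS.ln.injEq,
      ite_true, ite_false, not_false_eq_true, implies_true, Nat.max_zero, Nat.zero_max,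
      List.take_length, List.drop_length, List.nil_append, List.append_nil, le_refl, List.take_append_drop, List.length_nil, List.length_append,
      tsub_tsub_le]
  have b_r : ∀ r, (∀ i, r ≠ ρ i) → X2.sc r = σ.sc r := fun r hr => by
    rw [← a_r r hr, ← pr r (fun i => hr (.pm i))]; simp only [hr, hX2, yC, yA, yB, yF, yGG, yH, yG, yRB, yn, yk, yk2, yone, ym1, yt, yln, ycu, ycv, yacc, yacc2, yaccL, htake1, hdrop1, hminT, length_mulCoeffs, List.length_take, teeN_eq 𝓔 _ ho, moveN_eq' 𝓔, invS1, invS3, invS5, invInit, eval_seq, eval,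
      NState.sc_bump, NState.sc_setSc, NState.sc_setVi, NState.sc_setVo, NState.vi_bump,
      NState.vi_setSc, NState.vi_setVi, NState.vi_setVo, NState.vo_bump, NState.vo_setSc, NState.vo_setVi, NState.vo_setVo,
      NState.steps_bump, NState.steps_setSc, NState.steps_setVi, NState.steps_setVo, NState.peak_bump, NState.peak_setSc, NState.peak_setVi,
      NState.peak_setVo, Function.update_apply, EmbeddingLike.apply_eq_iff_eq, reduceCtorEq, InvV.pv.injEq, InvS.pm.injEq, InvS.ln.injEq,
      ite_true, ite_false, not_false_eq_true, implies_true, Nat.max_zero, Nat.zero_max,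
      List.take_length, List.drop_length, List.nil_append, List.append_nil, le_refl, List.take_append_drop, List.length_nil, List.length_append,
      tsub_tsub_le]
  obtain ⟨bA, bB, bG, bRB, bC, bF, bGG, bH, bacc, bacc2, baccL, bk2, bla, blb, bn, bln, bcu, bcv, bone, bm1, bk, bt, bcnt, bpk⟩ :
      X2.vi (ν (.pv .A)) = mulCoeffs (σ.sc (ρ (.pm .n))) g g ∧
      X2.vi (ν (.pv .B)) = h.take (g.length + g.length - (g.length + g.length - h.length)) ∧
      X2.vi (ν .G) = g ∧
      X2.vi (ν .RB) = h ∧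
      X2.vi (ν (.pv .C)) = [] ∧
      X2.vi (ν (.pv .F)) = [] ∧
      X2.vi (ν (.pv .G)) = [] ∧
      X2.vi (ν (.pv .H)) = [] ∧
      X2.vo (ω .acc) = [] ∧
      X2.vo (ω .acc2) = [] ∧
      X2.vo (ω .accL) = [] ∧
      X2.sc (ρ .k2) = g.length + g.length - (g.length + g.length - h.length) ∧
      X2.sc (ρ (.pm .la)) = g.length + g.length - 1 ∧
      X2.sc (ρ (.pm .lb)) = g.length + g.length - (g.length + g.length - h.length) ∧
      X2.sc (ρ (.pm .n)) = σ.sc (ρ (.pm .n)) ∧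
      X2.sc (ρ (.ln .n)) = σ.sc (ρ (.pm .n)) ∧
      X2.sc (ρ (.ln .cu)) = 2 ∧
      X2.sc (ρ (.ln .cv)) = 1 ∧
      X2.sc (ρ .one) = 1 ∧
      X2.sc (ρ .m1) = h.length ∧
      X2.sc (ρ .k) = g.length ∧
      X2.sc (ρ .t) = σ.sc (ρ .t) ∧
      X2.sc (ρ (.ln .cnt)) = g.length + g.length - (g.length + g.length - h.length) ∧
      X2.peak = max Y1.peak (g.length + g.length) := by
    refine ⟨?_, ?_, ?_, ?_, ?_, ?_, ?_, ?_, ?_, ?_, ?_, ?_, ?_, ?_, ?_, ?_, ?_, ?_, ?_, ?_, ?_, ?_, ?_, ?_⟩ <;>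
      simp only [hX2, yC, yA, yB, yF, yGG, yH, yG, yRB, yn, yk, yk2, yone, ym1, yt, yln, ycu, ycv, yacc, yacc2, yaccL, htake1, hdrop1, hminT, length_mulCoeffs, List.length_take, teeN_eq 𝓔 _ ho, moveN_eq' 𝓔, invS1, invS3, invS5, invInit, eval_seq, eval,
      NState.sc_bump, NState.sc_setSc, NState.sc_setVi, NState.sc_setVo, NState.vi_bump,
      NState.vi_setSc, NState.vi_setVi, NState.vi_setVo, NState.vo_bump, NState.vo_setSc, NState.vo_setVi, NState.vo_setVo,
      NState.steps_bump, NState.steps_setSc, NState.steps_setVi, NState.steps_setVo, NState.peak_bump, NState.peak_setSc, NState.peak_setVi,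
      NState.peak_setVo, Function.update_apply, EmbeddingLike.apply_eq_iff_eq, reduceCtorEq, InvV.pv.injEq, InvS.pm.injEq, InvS.ln.injEq,
      ite_true, ite_false, not_false_eq_true, implies_true, Nat.max_zero, Nat.zero_max,
      List.take_length, List.drop_length, List.nil_append, List.append_nil, le_refl, List.take_append_drop, List.length_nil, List.length_append,
      tsub_tsub_le]
  have bst : X2.steps = Y1.steps + 1 + 1 + 3 * (g.length + g.length - 1) + 1 + (g.length + g.length - 1 + 1) + 4 * (g.length + g.length - (g.length + g.length - h.length)) + 1 +
      (g.length + g.length - (g.length + g.length - h.length) + 1) + (g.length + g.length - (g.length + g.length - h.length) + 1) + 1 + 1 + 1 := by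
    simp only [hX2, yC, yA, yB, yF, yGG, yH, yG, yRB, yn, yk, yk2, yone, ym1, yt, yln, ycu, ycv, yacc, yacc2, yaccL, htake1, hdrop1, hminT, length_mulCoeffs, List.length_take, teeN_eq 𝓔 _ ho, moveN_eq' 𝓔, invS1, invS3, invS5, invInit, eval_seq, eval,
      NState.sc_bump, NState.sc_setSc, NState.sc_setVi, NState.sc_setVo, NState.vi_bump,
      NState.vi_setSc, NState.vi_setVi, NState.vi_setVo, NState.vo_bump, NState.vo_setSc, NState.vo_setVi, NState.vo_setVo,
      NState.steps_bump, NState.steps_setSc, NState.steps_setVi, NState.steps_setVo, NState.peak_bump, NState.peak_setSc, NState.peak_setVi,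
      NState.peak_setVo, Function.update_apply, EmbeddingLike.apply_eq_iff_eq, reduceCtorEq, InvV.pv.injEq, InvS.pm.injEq, InvS.ln.injEq,
      ite_true, ite_false, not_false_eq_true, implies_true, Nat.max_zero, Nat.zero_max,
      List.take_length, List.drop_length, List.nil_append, List.append_nil, le_refl, List.take_append_drop, List.length_nil, List.length_append,
      tsub_tsub_le]
  -- the second product
  obtain ⟨q1, qA, qB, qF, qG, qH, qw, qvo, qn, qla, qlb, qr, qpk, qst⟩ :=
    pmulP_spec (𝓔 := 𝓔) M (InvS.pmE.trans ρ) (InvV.pvE.trans ν) (ω .acc) X2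
      (by show 1 < X2.sc (ρ (.pm .n)); rw [bn]; exact hN)
      (by show X2.sc (ρ (.pm .la)) = (X2.vi (ν (.pv .A))).length; rw [bla, bA, length_mulCoeffs])
      (by show X2.sc (ρ (.pm .lb)) = (X2.vi (ν (.pv .B))).length; rw [blb, bB, List.length_take, hminT])
      (by show 0 < (X2.vi (ν (.pv .A))).length; rw [bA, length_mulCoeffs]; exact hggl')
      (by show 0 < (X2.vi (ν (.pv .B))).length; rw [bB, List.length_take, hminT]; exact hT0)
      (by show ∀ x ∈ X2.vi (ν (.pv .B)), x < X2.sc (ρ (.pm .n)); rw [bB, bn]; exact hhN') bF bGG bC bacc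
  rw [← hY2] at q1 qA qB qF qG qH qw qvo qn qla qlb qr qpk qst
  simp only [Function.Embedding.trans_apply, InvS.pmE_apply, InvV.pvE_apply, InvS.lnE_apply] at q1 qA qB qF qG qH qw qn qla qlb qr qpk qst
  set c := mulCoeffs (σ.sc (ρ (.pm .n))) (mulCoeffs (σ.sc (ρ (.pm .n))) g g) (h.take (g.length + g.length - (g.length + g.length - h.length))) with hc
  have zC : Y2.vi (ν (.pv .C)) = c := by rw [q1, bn, bA, bB]
  have zv : ∀ w : InvV, (∀ i, w ≠ .pv i) → Y2.vi (ν w) = X2.vi (ν w) := fun w hw => qw _ (fun i => by simpa using hw i)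
  have zs : ∀ r : InvS, (∀ i, r ≠ .pm i) → Y2.sc (ρ r) = X2.sc (ρ r) := fun r hr => qr _ (fun i => by simpa using hr i)
  have zG : Y2.vi (ν .G) = g := (zv .G (by simp)).trans bG
  have zRB : Y2.vi (ν .RB) = h := (zv .RB (by simp)).trans bRB
  have zA : Y2.vi (ν (.pv .A)) = [] := qA
  have zB : Y2.vi (ν (.pv .B)) = [] := qB
  have zF : Y2.vi (ν (.pv .F)) = [] := qF
  have zGG : Y2.vi (ν (.pv .G)) = [] := qG
  have zH : Y2.vi (ν (.pv .H)) = [] := qH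
  have zn : Y2.sc (ρ (.pm .n)) = σ.sc (ρ (.pm .n)) := qn.trans bn
  have zk2 : Y2.sc (ρ .k2) = g.length + g.length - (g.length + g.length - h.length) := (zs .k2 (by simp)).trans bk2
  have zone : Y2.sc (ρ .one) = 1 := (zs .one (by simp)).trans bone
  have zm1 : Y2.sc (ρ .m1) = h.length := (zs .m1 (by simp)).trans bm1
  have zt : Y2.sc (ρ .t) = σ.sc (ρ .t) := (zs .t (by simp)).trans bt
  have zln : Y2.sc (ρ (.ln .n)) = σ.sc (ρ (.pm .n)) := (zs (.ln .n) (by simp)).trans bln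
  have zcu : Y2.sc (ρ (.ln .cu)) = 2 := (zs (.ln .cu) (by simp)).trans bcu
  have zcv : Y2.sc (ρ (.ln .cv)) = 1 := (zs (.ln .cv) (by simp)).trans bcv
  have zcnt : Y2.sc (ρ (.ln .cnt)) = g.length + g.length - (g.length + g.length - h.length) := (zs (.ln .cnt) (by simp)).trans bcnt
  have zacc : Y2.vo (ω .acc) = [] := by rw [qvo, bacc]
  have zacc2 : Y2.vo (ω .acc2) = [] := by rw [qvo, bacc2]
  have zaccL : Y2.vo (ω .accL) = [] := by rw [qvo, baccL]
  have hcl : c.length = g.length + g.length - 1 + (g.length + g.length - (g.length + g.length - h.length)) - 1 := by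
    rw [hc, length_mulCoeffs, length_mulCoeffs, List.length_take, hminT]
  -- the linear combination
  obtain ⟨l1, l2, l3, l4, l5, l6, l7, l8, l9⟩ := linP_spec 𝓔 (InvS.lnE.trans ρ) (ν .G) (ν (.pv .C)) (ω .accL) huv Y2 (U := σ.sc (ρ (.pm .n)))
    (by rw [zG]; exact fun a ha => (hgN a ha).le)
    (by simp only [Function.Embedding.trans_apply, InvS.pmE_apply, InvV.pvE_apply, InvS.lnE_apply]; rw [zcnt, zC, hcl]; omega)
  simp only [Function.Embedding.trans_apply, InvS.pmE_apply, InvV.pvE_apply, InvS.lnE_apply] at l1 l2 l3 l4 l5 l6 l7 l8 l9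
  have wG : ((linP (InvS.lnE.trans ρ) (ν .G) (ν (.pv .C)) (ω .accL) : NCom S V O E).eval 𝓔 Y2).vi (ν .G) = [] := by
    rw [l1, zG, zcnt]; exact List.drop_of_length_le hTk
  have waccL : ((linP (InvS.lnE.trans ρ) (ν .G) (ν (.pv .C)) (ω .accL) : NCom S V O E).eval 𝓔 Y2).vo (ω .accL) = g' := by
    rw [l3, zaccL, zln, zcu, zcv, zG, zC, zcnt, List.nil_append, hc]
    simp only [g', k2, ← hT]
  have ws : ∀ r : InvS, (∀ i, r ≠ .ln i) → ((linP (InvS.lnE.trans ρ) (ν .G) (ν (.pv .C)) (ω .accL) : NCom S V O E).eval 𝓔 Y2).sc (ρ r) = Y2.sc (ρ r) :=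
    fun r hr => l5 _ (fun i => by simpa using hr i)
  have wl : ∀ j : LinS, j ≠ .a → j ≠ .b → j ≠ .y → j ≠ .q → j ≠ .r → ((linP (InvS.lnE.trans ρ) (ν .G) (ν (.pv .C)) (ω .accL) : NCom S V O E).eval 𝓔 Y2).sc (ρ (.ln j)) = Y2.sc (ρ (.ln j)) :=
    fun j h1 h2 h3 h4 h5 => l4 j h1 h2 h3 h4 h5
  have wv : ∀ w, w ≠ ν .G → w ≠ ν (.pv .C) → ((linP (InvS.lnE.trans ρ) (ν .G) (ν (.pv .C)) (ω .accL) : NCom S V O E).eval 𝓔 Y2).vi w = Y2.vi w := l6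
  have wo : ∀ p, p ≠ ω .accL → ((linP (InvS.lnE.trans ρ) (ν .G) (ν (.pv .C)) (ω .accL) : NCom S V O E).eval 𝓔 Y2).vo p = Y2.vo p := l7
  have lRB : ((linP (InvS.lnE.trans ρ) (ν .G) (ν (.pv .C)) (ω .accL) : NCom S V O E).eval 𝓔 Y2).vi (ν .RB) = h := (wv _ (by simp) (by simp)).trans zRB
  have lA : ((linP (InvS.lnE.trans ρ) (ν .G) (ν (.pv .C)) (ω .accL) : NCom S V O E).eval 𝓔 Y2).vi (ν (.pv .A)) = [] := (wv _ (by simp) (by simp)).trans zA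
  have lB : ((linP (InvS.lnE.trans ρ) (ν .G) (ν (.pv .C)) (ω .accL) : NCom S V O E).eval 𝓔 Y2).vi (ν (.pv .B)) = [] := (wv _ (by simp) (by simp)).trans zB
  have lF : ((linP (InvS.lnE.trans ρ) (ν .G) (ν (.pv .C)) (ω .accL) : NCom S V O E).eval 𝓔 Y2).vi (ν (.pv .F)) = [] := (wv _ (by simp) (by simp)).trans zF
  have lGG : ((linP (InvS.lnE.trans ρ) (ν .G) (ν (.pv .C)) (ω .accL) : NCom S V O E).eval 𝓔 Y2).vi (ν (.pv .G)) = [] := (wv _ (by simp) (by simp)).trans zGG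
  have lH : ((linP (InvS.lnE.trans ρ) (ν .G) (ν (.pv .C)) (ω .accL) : NCom S V O E).eval 𝓔 Y2).vi (ν (.pv .H)) = [] := (wv _ (by simp) (by simp)).trans zH
  have lacc : ((linP (InvS.lnE.trans ρ) (ν .G) (ν (.pv .C)) (ω .accL) : NCom S V O E).eval 𝓔 Y2).vo (ω .acc) = [] := (wo _ (by simp)).trans zacc
  have lacc2 : ((linP (InvS.lnE.trans ρ) (ν .G) (ν (.pv .C)) (ω .accL) : NCom S V O E).eval 𝓔 Y2).vo (ω .acc2) = [] := (wo _ (by simp)).trans zacc2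
  have lk2 : ((linP (InvS.lnE.trans ρ) (ν .G) (ν (.pv .C)) (ω .accL) : NCom S V O E).eval 𝓔 Y2).sc (ρ .k2) = g.length + g.length - (g.length + g.length - h.length) := (ws .k2 (by simp)).trans zk2
  have ln' : ((linP (InvS.lnE.trans ρ) (ν .G) (ν (.pv .C)) (ω .accL) : NCom S V O E).eval 𝓔 Y2).sc (ρ (.pm .n)) = σ.sc (ρ (.pm .n)) := (ws (.pm .n) (by simp)).trans zn
  have lln : ((linP (InvS.lnE.trans ρ) (ν .G) (ν (.pv .C)) (ω .accL) : NCom S V O E).eval 𝓔 Y2).sc (ρ (.ln .n)) = σ.sc (ρ (.pm .n)) := (wl .n (by simp) (by simp) (by simp) (by simp) (by simp)).trans zln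
  have lcu : ((linP (InvS.lnE.trans ρ) (ν .G) (ν (.pv .C)) (ω .accL) : NCom S V O E).eval 𝓔 Y2).sc (ρ (.ln .cu)) = 2 := (wl .cu (by simp) (by simp) (by simp) (by simp) (by simp)).trans zcu
  have lcv : ((linP (InvS.lnE.trans ρ) (ν .G) (ν (.pv .C)) (ω .accL) : NCom S V O E).eval 𝓔 Y2).sc (ρ (.ln .cv)) = 1 := (wl .cv (by simp) (by simp) (by simp) (by simp) (by simp)).trans zcv
  have lone : ((linP (InvS.lnE.trans ρ) (ν .G) (ν (.pv .C)) (ω .accL) : NCom S V O E).eval 𝓔 Y2).sc (ρ .one) = 1 := (ws .one (by simp)).trans zone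
  have lm1 : ((linP (InvS.lnE.trans ρ) (ν .G) (ν (.pv .C)) (ω .accL) : NCom S V O E).eval 𝓔 Y2).sc (ρ .m1) = h.length := (ws .m1 (by simp)).trans zm1
  have lt' : ((linP (InvS.lnE.trans ρ) (ν .G) (ν (.pv .C)) (ω .accL) : NCom S V O E).eval 𝓔 Y2).sc (ρ .t) = σ.sc (ρ .t) := (ws .t (by simp)).trans zt
  have lC : ((linP (InvS.lnE.trans ρ) (ν .G) (ν (.pv .C)) (ω .accL) : NCom S V O E).eval 𝓔 Y2).vi (ν (.pv .C)) = c.drop (g.length + g.length - (g.length + g.length - h.length)) := by rw [l2, zC, zcnt]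
  -- the last three instructions
  obtain ⟨tG, tRB, tC, tA, tB, tF, tGG, tH, tacc, tacc2, taccL, tk, tn, tln, tcu, tcv, tone, tm1, tt, tpk, tst⟩ :
      τ.vi (ν .G) = g' ∧
      τ.vi (ν .RB) = h ∧
      τ.vi (ν (.pv .C)) = [] ∧
      τ.vi (ν (.pv .A)) = [] ∧
      τ.vi (ν (.pv .B)) = [] ∧
      τ.vi (ν (.pv .F)) = [] ∧
      τ.vi (ν (.pv .G)) = [] ∧
      τ.vi (ν (.pv .H)) = [] ∧
      τ.vo (ω .acc) = [] ∧
      τ.vo (ω .acc2) = [] ∧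
      τ.vo (ω .accL) = [] ∧
      τ.sc (ρ .k) = g.length + g.length - (g.length + g.length - h.length) ∧
      τ.sc (ρ (.pm .n)) = σ.sc (ρ (.pm .n)) ∧
      τ.sc (ρ (.ln .n)) = σ.sc (ρ (.pm .n)) ∧
      τ.sc (ρ (.ln .cu)) = 2 ∧
      τ.sc (ρ (.ln .cv)) = 1 ∧
      τ.sc (ρ .one) = 1 ∧
      τ.sc (ρ .m1) = h.length ∧
      τ.sc (ρ .t) = σ.sc (ρ .t) ∧
      τ.peak = ((linP (InvS.lnE.trans ρ) (ν .G) (ν (.pv .C)) (ω .accL) : NCom S V O E).eval 𝓔 Y2).peak ∧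
      τ.steps = ((linP (InvS.lnE.trans ρ) (ν .G) (ν (.pv .C)) (ω .accL) : NCom S V O E).eval 𝓔 Y2).steps + ((((linP (InvS.lnE.trans ρ) (ν .G) (ν (.pv .C)) (ω .accL) : NCom S V O E).eval 𝓔 Y2).vi (ν (.pv .C))).length + 1) + (g'.length + 1) + 1 := by
    refine ⟨?_, ?_, ?_, ?_, ?_, ?_, ?_, ?_, ?_, ?_, ?_, ?_, ?_, ?_, ?_, ?_, ?_, ?_, ?_, ?_, ?_⟩ <;>
      simp only [hτ, wG, waccL, lRB, lA, lB, lF, lGG, lH, lacc, lacc2, lk2, ln', lln, lcu, lcv, lone, lm1, lt', lC, teeN_eq 𝓔 _ ho, moveN_eq' 𝓔, invS1, invS3, invS5, invInit, eval_seq, eval,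
      NState.sc_bump, NState.sc_setSc, NState.sc_setVi, NState.sc_setVo, NState.vi_bump,
      NState.vi_setSc, NState.vi_setVi, NState.vi_setVo, NState.vo_bump, NState.vo_setSc, NState.vo_setVi, NState.vo_setVo,
      NState.steps_bump, NState.steps_setSc, NState.steps_setVi, NState.steps_setVo, NState.peak_bump, NState.peak_setSc, NState.peak_setVi,
      NState.peak_setVo, Function.update_apply, EmbeddingLike.apply_eq_iff_eq, reduceCtorEq, InvV.pv.injEq, InvS.pm.injEq, InvS.ln.injEq,
      ite_true, ite_false, not_false_eq_true, implies_true, Nat.max_zero, Nat.zero_max,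
      List.take_length, List.drop_length, List.nil_append, List.append_nil, le_refl, List.take_append_drop, List.length_nil, List.length_append,
      tsub_tsub_le]
  have t_w : ∀ w, (∀ i, w ≠ ν i) → τ.vi w = σ.vi w := fun w hw => by
    rw [← b_w w hw, ← qw w (fun i => hw (.pv i)), ← wv w (hw .G) (hw (.pv .C))]; simp only [hw, hτ, wG, waccL, lRB, lA, lB, lF, lGG, lH, lacc, lacc2, lk2, ln', lln, lcu, lcv, lone, lm1, lt', lC, teeN_eq 𝓔 _ ho, moveN_eq' 𝓔, invS1, invS3, invS5, invInit, eval_seq, eval,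
      NState.sc_bump, NState.sc_setSc, NState.sc_setVi, NState.sc_setVo, NState.vi_bump,
      NState.vi_setSc, NState.vi_setVi, NState.vi_setVo, NState.vo_bump, NState.vo_setSc, NState.vo_setVi, NState.vo_setVo,
      NState.steps_bump, NState.steps_setSc, NState.steps_setVi, NState.steps_setVo, NState.peak_bump, NState.peak_setSc, NState.peak_setVi,
      NState.peak_setVo, Function.update_apply, EmbeddingLike.apply_eq_iff_eq, reduceCtorEq, InvV.pv.injEq, InvS.pm.injEq, InvS.ln.injEq,
      ite_true, ite_false, not_false_eq_true, implies_true, Nat.max_zero, Nat.zero_max,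
      List.take_length, List.drop_length, List.nil_append, List.append_nil, le_refl, List.take_append_drop, List.length_nil, List.length_append,
      tsub_tsub_le]
  have t_p : ∀ p, (∀ i, p ≠ ω i) → τ.vo p = σ.vo p := fun p hp => by
    rw [← b_p p hp, ← qvo, ← wo p (hp .accL)]; simp only [hp, hτ, wG, waccL, lRB, lA, lB, lF, lGG, lH, lacc, lacc2, lk2, ln', lln, lcu, lcv, lone, lm1, lt', lC, teeN_eq 𝓔 _ ho, moveN_eq' 𝓔, invS1, invS3, invS5, invInit, eval_seq, eval,
      NState.sc_bump, NState.sc_setSc, NState.sc_setVi, NState.sc_setVo, NState.vi_bump,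
      NState.vi_setSc, NState.vi_setVi, NState.vi_setVo, NState.vo_bump, NState.vo_setSc, NState.vo_setVi, NState.vo_setVo,
      NState.steps_bump, NState.steps_setSc, NState.steps_setVi, NState.steps_setVo, NState.peak_bump, NState.peak_setSc, NState.peak_setVi,
      NState.peak_setVo, Function.update_apply, EmbeddingLike.apply_eq_iff_eq, reduceCtorEq, InvV.pv.injEq, InvS.pm.injEq, InvS.ln.injEq,
      ite_true, ite_false, not_false_eq_true, implies_true, Nat.max_zero, Nat.zero_max,
      List.take_length, List.drop_length, List.nil_append, List.append_nil, le_refl, List.take_append_drop, List.length_nil, List.length_append,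
      tsub_tsub_le]
  have t_r : ∀ s', (∀ i, s' ≠ ρ i) → τ.sc s' = σ.sc s' := fun s' hr => by
    rw [← b_r s' hr, ← qr s' (fun i => hr (.pm i)), ← l5 s' (fun i => hr (.ln i))]; simp only [hr, hτ, wG, waccL, lRB, lA, lB, lF, lGG, lH, lacc, lacc2, lk2, ln', lln, lcu, lcv, lone, lm1, lt', lC, teeN_eq 𝓔 _ ho, moveN_eq' 𝓔, invS1, invS3, invS5, invInit, eval_seq, eval,
      NState.sc_bump, NState.sc_setSc, NState.sc_setVi, NState.sc_setVo, NState.vi_bump,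
      NState.vi_setSc, NState.vi_setVi, NState.vi_setVo, NState.vo_bump, NState.vo_setSc, NState.vo_setVi, NState.vo_setVo,
      NState.steps_bump, NState.steps_setSc, NState.steps_setVi, NState.steps_setVo, NState.peak_bump, NState.peak_setSc, NState.peak_setVi,
      NState.peak_setVo, Function.update_apply, EmbeddingLike.apply_eq_iff_eq, reduceCtorEq, InvV.pv.injEq, InvS.pm.injEq, InvS.ln.injEq,
      ite_true, ite_false, not_false_eq_true, implies_true, Nat.max_zero, Nat.zero_max,
      List.take_length, List.drop_length, List.nil_append, List.append_nil, le_refl, List.take_append_drop, List.length_nil, List.length_append,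
      tsub_tsub_le]
  have hg'l : g'.length = g.length + g.length - (g.length + g.length - h.length) := by simp only [g', length_linc, k2, ← hT]
  have hg'N : ∀ x ∈ g', x < σ.sc (ρ (.pm .n)) := fun x hx => lt_of_mem_linc (by omega) hx
  have hinv' : Polynomial.X ^ g'.length ∣ listPoly (σ.sc (ρ (.pm .n))) h * listPoly (σ.sc (ρ (.pm .n))) g' - 1 := by
    rw [hg'l, hT]; exact newton_linc hN hk1 hinv
  have hext : (invBody M ρ ν ω : NCom S V O E).extOK 𝓔 σ := by
    show ((invS1 ρ ν ω ;ₙ (pmulP M ρp νp (ω .acc) ;ₙ (invS3 ρ ν ω ;ₙ (pmulP M ρp νp (ω .acc) ;ₙ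
      (linP ρl (ν .G) (ν (.pv .C)) (ω .accL) ;ₙ invS5 ρ ν ω))))) : NCom S V O E).extOK 𝓔 σ
    rw [extOK_seq, extOK_seq, extOK_seq, extOK_seq, extOK_seq, ← hX1, ← hY1, ← hX2, ← hY2]
    refine ⟨extOK_of_noExt 𝓔 (invS_noExt ρ ν ω).1 σ, ?_, extOK_of_noExt 𝓔 (invS_noExt ρ ν ω).2.1 _, ?_,
      extOK_of_noExt 𝓔 (linP_noExt _ _ _ _) _, extOK_of_noExt 𝓔 (invS_noExt ρ ν ω).2.2.1 _⟩
    · exact pmulP_extOK (𝓔 := 𝓔) M (InvS.pmE.trans ρ) (InvV.pvE.trans ν) (ω .acc) X1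
        (by show 1 < X1.sc (ρ (.pm .n)); rw [an]; exact hN) (by show Odd (X1.sc (ρ (.pm .n))); rw [an]; exact hodd)
        (by show X1.sc (ρ (.pm .la)) = (X1.vi (ν (.pv .A))).length; rw [ala, aA])
        (by show X1.sc (ρ (.pm .lb)) = (X1.vi (ν (.pv .B))).length; rw [alb, aB])
        (by show 0 < (X1.vi (ν (.pv .A))).length; rw [aA]; exact hk0) (by show 0 < (X1.vi (ν (.pv .B))).length; rw [aB]; exact hk0)
        (by show ∀ x ∈ X1.vi (ν (.pv .A)), x < X1.sc (ρ (.pm .n)); rw [aA, an]; exact hgN)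
        (by show ∀ x ∈ X1.vi (ν (.pv .B)), x < X1.sc (ρ (.pm .n)); rw [aB, an]; exact hgN) aF aGG aacc
    · exact pmulP_extOK (𝓔 := 𝓔) M (InvS.pmE.trans ρ) (InvV.pvE.trans ν) (ω .acc) X2
        (by show 1 < X2.sc (ρ (.pm .n)); rw [bn]; exact hN) (by show Odd (X2.sc (ρ (.pm .n))); rw [bn]; exact hodd)
        (by show X2.sc (ρ (.pm .la)) = (X2.vi (ν (.pv .A))).length; rw [bla, bA, length_mulCoeffs])
        (by show X2.sc (ρ (.pm .lb)) = (X2.vi (ν (.pv .B))).length; rw [blb, bB, List.length_take, hminT])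
        (by show 0 < (X2.vi (ν (.pv .A))).length; rw [bA, length_mulCoeffs]; exact hggl')
        (by show 0 < (X2.vi (ν (.pv .B))).length; rw [bB, List.length_take, hminT]; exact hT0)
        (by show ∀ x ∈ X2.vi (ν (.pv .A)), x < X2.sc (ρ (.pm .n)); rw [bA, bn]; exact hggN)
        (by show ∀ x ∈ X2.vi (ν (.pv .B)), x < X2.sc (ρ (.pm .n)); rw [bB, bn]; exact hhN') bF bGG bacc
  refine ⟨⟨?_, ?_, ?_, tcu, tcv, tone, tm1, ?_, ?_, ?_, tRB, tG, ?_, ?_, ?_, tA, tB, tF, tGG, tH, tC, tacc, tacc2, taccL⟩,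
    t_w, t_p, t_r, tt, tn, ?_, ?_, hext⟩
  · rw [tn]; exact hN
  · rw [tn]; exact hodd
  · rw [tln, tn]
  · rw [tk, hg'l]
  · rw [hg'l]; exact hT0
  · rw [hg'l]; exact hTh
  · rw [tn]; exact hhN
  · rw [tn]; exact hg'N
  · rw [tn]; exact hinv'
  · -- peak
    rw [tpk]
    have e1 := l8; rw [zcu, zcv, zln] at e1
    have e2 := qpk; rw [bpk, bn, bla, blb] at e2
    have e3 := ypk
    generalize ((linP (InvS.lnE.trans ρ) (ν .G) (ν (.pv .C)) (ω .accL) : NCom S V O E).eval 𝓔 Y2).peak = Lp at e1 ⊢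
    clear * - e1 e2 e3 hmul hkm
    refine e1.trans (max_le (e2.trans (max_le (max_le (e3.trans ?_) ?_) ?_)) ?_) <;> omega
  · -- steps
    rw [tst, lC, List.length_drop, hcl, hg'l]
    have e1 := l9; rw [zcnt] at e1
    have e2 := qst; rw [bst, bla, blb] at e2
    have e3 := yst
    have hc1 : M.cost (2 * (g.length + g.length - 1 + (g.length + g.length - (g.length + g.length - h.length)))) ≤ M.cost (6 * h.length) := M.cost_mono h6
    have hc2 : M.cost (4 * g.length) ≤ M.cost (4 * h.length) := M.cost_mono h4
    generalize ((linP (InvS.lnE.trans ρ) (ν .G) (ν (.pv .C)) (ω .accL) : NCom S V O E).eval 𝓔 Y2).steps = Ls at e1 ⊢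
    clear * - e1 e2 e3 hc1 hc2 hkm hk1 hTh hT0
    omega

/-- The Newton iterates on coefficient lists: `g₀ = [1]`,
`g_{i+1} = (2 g_i - h g_i² mod x^{k}) mod x^{k}` with `k = min (2 |g_i|, |h|)`. [folklore] -/
noncomputable def newtonIter (N : ℕ) (h : List ℕ) : ℕ → List ℕ
  | 0 => [1]
  | i + 1 =>
    linc N 2 1 (newtonIter N h i) (mulCoeffs N (mulCoeffs N (newtonIter N h i) (newtonIter N h i)) (h.take (min (2 * (newtonIter N h i).length) h.length)))
      (min (2 * (newtonIter N h i).length) h.length)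

/-- Length of the Newton iterates (`1 ≤ |h|`). [folklore] -/
theorem length_newtonIter (N : ℕ) {h : List ℕ} (hh : 1 ≤ h.length) : ∀ i, (newtonIter N h i).length = min (2 ^ i) h.length
  | 0 => by simp [newtonIter]; omega
  | i + 1 => by
    rw [newtonIter, length_linc, length_newtonIter N hh i, pow_succ]
    rcases le_total (2 ^ i) h.length with h1 | h1
    · rw [Nat.min_eq_left h1]; congr 1; ring
    · rw [Nat.min_eq_right h1, Nat.min_eq_right (by omega), Nat.min_eq_right (by omega)]

/-- **The inverse modulo `x^{|h|}`** computed by `invP`: the iterate after `size (|h| - 1)` rounds.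
[von zur Gathen–Gerhard 2013, Algorithm 9.3] [folklore] -/
noncomputable def newtonInv (N : ℕ) (h : List ℕ) : List ℕ := newtonIter N h (h.length - 1).size

/-- **Rounds of the Newton loop.** [folklore] -/
theorem invBody_iterate (σ : NState S V O) (h : List ℕ) (hI : InvInv ρ ν ω σ h [1]) :
    ∀ i, let τ := ((invBody M ρ ν ω : NCom S V O E).eval 𝓔)^[i] σ
      InvInv ρ ν ω τ h (newtonIter (σ.sc (ρ (.pm .n))) h i) ∧ (∀ w, (∀ i, w ≠ ν i) → τ.vi w = σ.vi w) ∧ (∀ p, (∀ i, p ≠ ω i) → τ.vo p = σ.vo p) ∧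
        (∀ r, (∀ i, r ≠ ρ i) → τ.sc r = σ.sc r) ∧ τ.sc (ρ .t) = σ.sc (ρ .t) ∧ τ.sc (ρ (.pm .n)) = σ.sc (ρ (.pm .n)) ∧
        τ.peak ≤ max σ.peak (max (3 * σ.sc (ρ (.pm .n))) (8 * h.length)) ∧
        τ.steps ≤ σ.steps + i * (200 * h.length + M.cost (4 * h.length) + M.cost (6 * h.length) + 100) ∧
        (invBody M ρ ν ω : NCom S V O E).extOK 𝓔 τ
  | 0 => ⟨hI, fun _ _ => rfl, fun _ _ => rfl, fun _ _ => rfl, rfl, rfl, le_max_left _ _, by simp,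
      (invBody_spec M ρ ν ω σ h [1] hI).2.2.2.2.2.2.2.2⟩
  | i + 1 => by
    obtain ⟨h1, h2, h3, h4, h5, h6, h7, h8, -⟩ := invBody_iterate σ h hI i
    intro τ
    have hτ : τ = (invBody M ρ ν ω : NCom S V O E).eval 𝓔 (((invBody M ρ ν ω : NCom S V O E).eval 𝓔)^[i] σ) := Function.iterate_succ_apply' _ _ _
    obtain ⟨r1, r2, r3, r4, r5, r6, r7, r8, -⟩ := invBody_spec M ρ ν ω _ h _ h1
    rw [h6] at r1 r6 r7
    have hnext : (invBody M ρ ν ω : NCom S V O E).extOK 𝓔 τ := by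
      rw [hτ]; exact (invBody_spec M ρ ν ω _ h _ (h6 ▸ (invBody_spec M ρ ν ω _ h _ h1).1)).2.2.2.2.2.2.2.2
    rw [hτ]
    refine ⟨?_, fun w hw => (r2 w hw).trans (h2 w hw), fun p hp => (r3 p hp).trans (h3 p hp), fun r hr => (r4 r hr).trans (h4 r hr),
      r5.trans h5, r6, r7.trans (max_le (h7.trans le_rfl) (le_max_right _ _)), ?_, hτ ▸ hnext⟩
    · simpa [newtonIter] using r1
    · rw [Nat.succ_mul]; omega

omit [DecidableEq S] [DecidableEq V] [DecidableEq O] in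
/-- `InvInv` only depends on the registers. [folklore] -/
theorem InvInv.bump {σ : NState S V O} {h g : List ℕ} (hI : InvInv ρ ν ω σ h g) (a k : ℕ) : InvInv ρ ν ω (σ.bump a k) h g := by
  obtain ⟨h1, h2, h3, h4, h5, h6, h7, h8, h9, h10, h11, h12, h13, h14, h15, h16, h17, h18, h19, h20, h21, h22, h23, h24⟩ := hI
  exact ⟨h1, h2, h3, h4, h5, h6, h7, h8, h9, h10, h11, h12, h13, h14, h15, h16, h17, h18, h19, h20, h21, h22, h23, h24⟩

/-- Length of the computed inverse (`1 ≤ |h|`). [folklore] -/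
theorem length_newtonInv (N : ℕ) {h : List ℕ} (hh : 1 ≤ h.length) : (newtonInv N h).length = h.length := by
  rw [newtonInv, length_newtonIter N hh, Nat.min_eq_right]
  have := Nat.lt_size_self (h.length - 1)
  omega

set_option linter.unusedSimpArgs false in -- one uniform simp set drives the symbolic execution
/-- **Specification of Newton inversion** `invP` (von zur Gathen–Gerhard 2013, Algorithm 9.3,
Theorem 9.4).  From `RB = h` (`m1 = |h| ≥ 1`, `h₀ = 1`, reduced entries, odd `N > 1`, empty
work queues): `G = newtonInv N h`, of length `|h|`, reduced, with `h · G ≡ 1 (mod x^{|h|})`;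
`RB` is kept; `steps ≤ steps + |G₀| + size |h| · (200 |h| + cost (4|h|) + cost (6|h|) + 101) + 12`.
[folklore] -/
theorem invP_spec (σ : NState S V O) (h : List ℕ) (hN : 1 < σ.sc (ρ (.pm .n))) (hodd : Odd (σ.sc (ρ (.pm .n))))
    (hRB : σ.vi (ν .RB) = h) (hm1 : σ.sc (ρ .m1) = h.length) (hh : 1 ≤ h.length) (hhN : ∀ x ∈ h, x < σ.sc (ρ (.pm .n)))
    (hh0 : h.head? = some 1)
    (hA : σ.vi (ν (.pv .A)) = []) (hB : σ.vi (ν (.pv .B)) = []) (hF : σ.vi (ν (.pv .F)) = []) (hGG : σ.vi (ν (.pv .G)) = [])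
    (hH : σ.vi (ν (.pv .H)) = []) (hC : σ.vi (ν (.pv .C)) = [])
    (hacc : σ.vo (ω .acc) = []) (hacc2 : σ.vo (ω .acc2) = []) (haccL : σ.vo (ω .accL) = []) :
    let τ := (invP M ρ ν ω : NCom S V O E).eval 𝓔 σ
    τ.vi (ν .G) = newtonInv (σ.sc (ρ (.pm .n))) h ∧ (∀ x ∈ newtonInv (σ.sc (ρ (.pm .n))) h, x < σ.sc (ρ (.pm .n))) ∧
      Polynomial.X ^ h.length ∣ listPoly (σ.sc (ρ (.pm .n))) h * listPoly (σ.sc (ρ (.pm .n))) (newtonInv (σ.sc (ρ (.pm .n))) h) - 1 ∧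
      τ.vi (ν .RB) = h ∧ τ.vi (ν (.pv .A)) = [] ∧ τ.vi (ν (.pv .B)) = [] ∧ τ.vi (ν (.pv .F)) = [] ∧ τ.vi (ν (.pv .G)) = [] ∧
      τ.vi (ν (.pv .H)) = [] ∧ τ.vi (ν (.pv .C)) = [] ∧ τ.vo (ω .acc) = [] ∧ τ.vo (ω .acc2) = [] ∧ τ.vo (ω .accL) = [] ∧
      (∀ w, (∀ i, w ≠ ν i) → τ.vi w = σ.vi w) ∧ (∀ p, (∀ i, p ≠ ω i) → τ.vo p = σ.vo p) ∧ (∀ r, (∀ i, r ≠ ρ i) → τ.sc r = σ.sc r) ∧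
      τ.sc (ρ (.pm .n)) = σ.sc (ρ (.pm .n)) ∧ τ.sc (ρ .m1) = h.length ∧
      τ.peak ≤ max σ.peak (max (3 * σ.sc (ρ (.pm .n))) (8 * h.length)) ∧
      τ.steps ≤ σ.steps + (σ.vi (ν .G)).length + h.length.size * (200 * h.length + M.cost (4 * h.length) + M.cost (6 * h.length) + 101) + 12 ∧
      (invP M ρ ν ω : NCom S V O E).extOK 𝓔 σ := by
  intro τ
  have ho : ω .acc ≠ ω .acc2 := by simp
  set X0 := (invInit ρ ν : NCom S V O E).eval 𝓔 σ with hX0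
  have hτ : τ = ((invBody M ρ ν ω : NCom S V O E).eval 𝓔)^[X0.sc (ρ .t)] (X0.bump 0 (X0.sc (ρ .t) + 1)) := by
    show ((invInit ρ ν ;ₙ times (ρ .t) (invBody M ρ ν ω) : NCom S V O E)).eval 𝓔 σ = _
    rw [eval_seq, eval_times]
  clear_value X0 τ
  obtain ⟨iRB, iG, iA, iB, iF, iGG, iH, iC, iacc, iacc2, iaccL, in', iln, icu, icv, ione, im1, ik, it, ipk, ist⟩ :
      X0.vi (ν .RB) = h ∧
      X0.vi (ν .G) = [1] ∧
      X0.vi (ν (.pv .A)) = [] ∧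
      X0.vi (ν (.pv .B)) = [] ∧
      X0.vi (ν (.pv .F)) = [] ∧
      X0.vi (ν (.pv .G)) = [] ∧
      X0.vi (ν (.pv .H)) = [] ∧
      X0.vi (ν (.pv .C)) = [] ∧
      X0.vo (ω .acc) = [] ∧
      X0.vo (ω .acc2) = [] ∧
      X0.vo (ω .accL) = [] ∧
      X0.sc (ρ (.pm .n)) = σ.sc (ρ (.pm .n)) ∧
      X0.sc (ρ (.ln .n)) = σ.sc (ρ (.pm .n)) ∧
      X0.sc (ρ (.ln .cu)) = 2 ∧
      X0.sc (ρ (.ln .cv)) = 1 ∧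
      X0.sc (ρ .one) = 1 ∧
      X0.sc (ρ .m1) = h.length ∧
      X0.sc (ρ .k) = 1 ∧
      X0.sc (ρ .t) = (h.length - 1).size ∧
      X0.peak = max (max (max (max (max σ.peak 1) 2) 1) 1) (h.length - 1).size ∧
      X0.steps = σ.steps + 1 + 1 + 1 + 1 + ((σ.vi (ν .G)).length + 1) + 1 + 1 + 1 + 1 := by
    refine ⟨?_, ?_, ?_, ?_, ?_, ?_, ?_, ?_, ?_, ?_, ?_, ?_, ?_, ?_, ?_, ?_, ?_, ?_, ?_, ?_, ?_⟩ <;>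
      simp only [hX0, hRB, hm1, hA, hB, hF, hGG, hH, hC, hacc, hacc2, haccL, teeN_eq 𝓔 _ ho, moveN_eq' 𝓔, invS1, invS3, invS5, invInit, eval_seq, eval,
      NState.sc_bump, NState.sc_setSc, NState.sc_setVi, NState.sc_setVo, NState.vi_bump,
      NState.vi_setSc, NState.vi_setVi, NState.vi_setVo, NState.vo_bump, NState.vo_setSc, NState.vo_setVi, NState.vo_setVo,
      NState.steps_bump, NState.steps_setSc, NState.steps_setVi, NState.steps_setVo, NState.peak_bump, NState.peak_setSc, NState.peak_setVi,
      NState.peak_setVo, Function.update_apply, EmbeddingLike.apply_eq_iff_eq, reduceCtorEq, InvV.pv.injEq, InvS.pm.injEq, InvS.ln.injEq,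
      ite_true, ite_false, not_false_eq_true, implies_true, Nat.max_zero, Nat.zero_max,
      List.take_length, List.drop_length, List.nil_append, List.append_nil, le_refl, List.take_append_drop, List.length_nil, List.length_append,
      tsub_tsub_le]
  have i_w : ∀ w, (∀ i, w ≠ ν i) → X0.vi w = σ.vi w := fun w hw => by simp only [hw, hX0, hRB, hm1, hA, hB, hF, hGG, hH, hC, hacc, hacc2, haccL, teeN_eq 𝓔 _ ho, moveN_eq' 𝓔, invS1, invS3, invS5, invInit, eval_seq, eval,
      NState.sc_bump, NState.sc_setSc, NState.sc_setVi, NState.sc_setVo, NState.vi_bump,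
      NState.vi_setSc, NState.vi_setVi, NState.vi_setVo, NState.vo_bump, NState.vo_setSc, NState.vo_setVi, NState.vo_setVo,
      NState.steps_bump, NState.steps_setSc, NState.steps_setVi, NState.steps_setVo, NState.peak_bump, NState.peak_setSc, NState.peak_setVi,
      NState.peak_setVo, Function.update_apply, EmbeddingLike.apply_eq_iff_eq, reduceCtorEq, InvV.pv.injEq, InvS.pm.injEq, InvS.ln.injEq,
      ite_true, ite_false, not_false_eq_true, implies_true, Nat.max_zero, Nat.zero_max,
      List.take_length, List.drop_length, List.nil_append, List.append_nil, le_refl, List.take_append_drop, List.length_nil, List.length_append,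
      tsub_tsub_le]
  have i_p : ∀ p, (∀ i, p ≠ ω i) → X0.vo p = σ.vo p := fun p hp => by simp only [hp, hX0, hRB, hm1, hA, hB, hF, hGG, hH, hC, hacc, hacc2, haccL, teeN_eq 𝓔 _ ho, moveN_eq' 𝓔, invS1, invS3, invS5, invInit, eval_seq, eval,
      NState.sc_bump, NState.sc_setSc, NState.sc_setVi, NState.sc_setVo, NState.vi_bump,
      NState.vi_setSc, NState.vi_setVi, NState.vi_setVo, NState.vo_bump, NState.vo_setSc, NState.vo_setVi, NState.vo_setVo,
      NState.steps_bump, NState.steps_setSc, NState.steps_setVi, NState.steps_setVo, NState.peak_bump, NState.peak_setSc, NState.peak_setVi,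
      NState.peak_setVo, Function.update_apply, EmbeddingLike.apply_eq_iff_eq, reduceCtorEq, InvV.pv.injEq, InvS.pm.injEq, InvS.ln.injEq,
      ite_true, ite_false, not_false_eq_true, implies_true, Nat.max_zero, Nat.zero_max,
      List.take_length, List.drop_length, List.nil_append, List.append_nil, le_refl, List.take_append_drop, List.length_nil, List.length_append,
      tsub_tsub_le]
  have i_r : ∀ r, (∀ i, r ≠ ρ i) → X0.sc r = σ.sc r := fun r hr => by simp only [hr, hX0, hRB, hm1, hA, hB, hF, hGG, hH, hC, hacc, hacc2, haccL, teeN_eq 𝓔 _ ho, moveN_eq' 𝓔, invS1, invS3, invS5, invInit, eval_seq, eval,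
      NState.sc_bump, NState.sc_setSc, NState.sc_setVi, NState.sc_setVo, NState.vi_bump,
      NState.vi_setSc, NState.vi_setVi, NState.vi_setVo, NState.vo_bump, NState.vo_setSc, NState.vo_setVi, NState.vo_setVo,
      NState.steps_bump, NState.steps_setSc, NState.steps_setVi, NState.steps_setVo, NState.peak_bump, NState.peak_setSc, NState.peak_setVi,
      NState.peak_setVo, Function.update_apply, EmbeddingLike.apply_eq_iff_eq, reduceCtorEq, InvV.pv.injEq, InvS.pm.injEq, InvS.ln.injEq,
      ite_true, ite_false, not_false_eq_true, implies_true, Nat.max_zero, Nat.zero_max,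
      List.take_length, List.drop_length, List.nil_append, List.append_nil, le_refl, List.take_append_drop, List.length_nil, List.length_append,
      tsub_tsub_le]
  have hinv0 : Polynomial.X ^ [1].length ∣ listPoly (σ.sc (ρ (.pm .n))) h * listPoly (σ.sc (ρ (.pm .n))) [1] - 1 := by
    rw [List.length_singleton, pow_one, Polynomial.X_dvd_iff]
    obtain ⟨l, rfl⟩ : ∃ l, h = 1 :: l := by
      cases h with
      | nil => simp at hh0
      | cons a l => simp only [List.head?_cons, Option.some.injEq] at hh0; exact ⟨l, by rw [hh0]⟩
    simp [listPoly_cons, listPoly_nil]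
  have hI0 : InvInv ρ ν ω (X0.bump 0 (X0.sc (ρ .t) + 1)) h [1] :=
    (⟨by rw [in']; exact hN, by rw [in']; exact hodd, by rw [iln, in'], icu, icv, ione, im1, ik, le_rfl, hh, iRB, iG,
      by rw [in']; exact hhN, by rw [in']; intro x hx; simp at hx; omega, by rw [in']; exact hinv0, iA, iB, iF, iGG, iH, iC, iacc, iacc2, iaccL⟩ :
      InvInv ρ ν ω X0 h [1]).bump ρ ν ω _ _
  obtain ⟨j1, j2, j3, j4, j5, j6, j7, j8, -⟩ := invBody_iterate M ρ ν ω _ h hI0 (X0.sc (ρ .t))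
  rw [← hτ] at j1 j2 j3 j4 j5 j6 j7 j8
  simp only [NState.sc_bump, NState.vi_bump, NState.vo_bump, NState.peak_bump, NState.steps_bump, Nat.max_zero, in', it] at j1 j2 j3 j4 j5 j6 j7 j8
  have hGi : newtonIter (σ.sc (ρ (.pm .n))) h (h.length - 1).size = newtonInv (σ.sc (ρ (.pm .n))) h := rfl
  rw [hGi] at j1
  obtain ⟨k1, k2, k3, k4, k5, k6, k7, k8, k9, k10, k11, k12, k13, k14, k15, k16, k17, k18, k19, k20, k21, k22, k23, k24⟩ := j1
  have hlen := length_newtonInv (σ.sc (ρ (.pm .n))) hh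
  refine ⟨k12, (fun x hx => lt_of_lt_of_eq (k14 x hx) j6), ?_, k11, k16, k17, k18, k19, k20, k21, k22, k23, k24, fun w hw => (j2 w hw).trans (i_w w hw),
    fun p hp => (j3 p hp).trans (i_p p hp), fun r hr => (j4 r hr).trans (i_r r hr), j6, k7, ?_, ?_, ?_⟩
  · have := k15; rwa [hlen, j6] at this
  · refine j7.trans (max_le ?_ (le_max_right _ _))
    rw [ipk]
    have hsz : (h.length - 1).size ≤ 8 * h.length := by
      have := Nat.size_le.2 (show h.length - 1 < 2 ^ h.length from (Nat.sub_le _ _).trans_lt Nat.lt_two_pow_self)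
      omega
    have h2N : 2 ≤ 3 * σ.sc (ρ (.pm .n)) := by omega
    clear * - hsz h2N
    refine max_le (max_le (max_le (max_le (max_le (le_max_left _ _) ?_) ?_) ?_) ?_) (le_max_of_le_right (le_max_of_le_right hsz)) <;>
      exact le_max_of_le_right (le_max_of_le_left (by omega))
  · have hs : (h.length - 1).size ≤ h.length.size := Nat.size_le_size (Nat.sub_le _ _)
    have e := j8; rw [ist] at e
    generalize hR : 200 * h.length + M.cost (4 * h.length) + M.cost (6 * h.length) = R at e ⊢
    have key : (h.length - 1).size * (R + 100) + ((h.length - 1).size + 1) ≤ h.length.size * (R + 101) + 1 := by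
      have := Nat.mul_le_mul_right (R + 101) hs
      have e2 : (h.length - 1).size * (R + 101) = (h.length - 1).size * (R + 100) + (h.length - 1).size := by ring
      omega
    clear * - e key
    omega
  · refine ⟨extOK_of_noExt 𝓔 (invS_noExt ρ ν ω).2.2.2 σ, ?_⟩
    rw [extOK_times, ← hX0]
    intro i hi
    exact (invBody_iterate M ρ ν ω _ h hI0 i).2.2.2.2.2.2.2.2

end Inv

end NCom

end Literature.Computability.Complexity
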